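import Literature.Analysis.FluidPDE.NSSuitableESSProofs
import Literature.Analysis.FluidPDE.NSWeakStrongUniqueness
import HarnessLib

/-!
# Local energy bounds for distributional Navier–Stokes solutions bounded away from the final time

Analysis/FluidPDE support file (theorem-only; serves the discharge of
`SereginSverak2009.GradientEnergyBound` — Seregin–Šverák 2009, proof of Lemma 3.5, (as6) with
Remark 3.4 and p. 6: "the pair `v` and `q`, satisfying conditions (b8)–(b10), is in fact a
suitable weak solution in `Q`. It is certainly true in `B × ]-1, -a²[` but condition (b8) allows
us to extend this property to the whole cylinder `Q`").

Let `(u, p)` solve the Navier–Stokes system (viscosity `ν > 0`, no force) in the sense of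
distributions on a bounded open space–time region `Q` (accepted
`IsDistributionalNSSolutionOn`), with `u ∈ L³(Q)`, `p ∈ L^{3/2}(Q)`. Mollify in space–time
(`Vₙ = kₙ ⋆ 𝟙_Q u`, `FluidPDE/SpaceTimeMollifier`) and fix a nonnegative space–time test function
`φ` with `φ(a, ·) = 0`. The main result `exists_eventually_mollified_energy_le` is the uniform
bound behind Remark 3.4: there is `M` (depending on `u, p, φ` only) such that for every time `t`
below which (i) the support of `φ` keeps a positive distance `δ` from the complement of `Q` and
(ii) `u` is essentially bounded on `Q ∩ {s < t + δ}` — hypothesis (r2) of Seregin–Šverák —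
one has, for all large `n`,
`∫ φ(t)|Vₙ(t)|² + 2ν ∫∫_{(a,t)×E} φ |D Vₙ|² ≤ M`.
Letting `t` increase to the final time this yields `∇u ∈ L²` and `u ∈ L^∞_t L²_x` on the
cylinder where `φ = 1`, up to the final time (`SereginSverakGradientEnergy`).

## Proof

The smooth local energy identity of the mollified system (`local_energy_identity_smooth`)
reads `∫ φ(t)|V|² + 2ν ∫∫ φ|DV|² = T₁ + 2T₂ₐ + 2T₂ᵦ + 2T₃` with
`T₂ᵦ = ∫∫ φ Σᵢ ⟪DV(Nᵢ), bᵢ⟫`, `Nᵢ = kₙ ⋆ 𝟙_Q(uᵢ u)`. Two passes: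

* (absorption, `smooth_local_energy_le_absorb`) `2|Σᵢ ⟪DV(Nᵢ), bᵢ⟫| ≤ ν|DV|² + (d+1)ν⁻¹ Σᵢ|Nᵢ|²`;
  below time `t` the fields `Nᵢ` only see `u` where it is bounded, so `Σ ∫∫ φ|Nᵢ|²` stays
  bounded and `∫∫_{s<t} φ|DVₙ|² ≤ M₁(t)` for large `n`;
* (transport, `smooth_local_energy_le_transport`) `Nᵢ = Vᵢ V + Rᵢ` with the commutators
  `Rᵢ = kₙ ⋆ (uᵢu) - (kₙ ⋆ u)ᵢ (kₙ ⋆ u) → 0` in `L²` below time `t` (there `u ∈ L^∞ ∩ L² ⊆ L⁴`),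
  `2 ∫∫ φ ⟪DV(V), V⟫ = -∫∫ |V|² V·∇φ` (`two_mul_integral_mul_inner_fderiv_self`), and
  `2|Σᵢ ⟪DV(Rᵢ), bᵢ⟫| ≤ η|DV|² + (d+1)η⁻¹ Σᵢ|Rᵢ|²` with `η M₁(t)` small; the remaining terms
  converge (`FluidPDE/MollifiedLimits`) to integrals over `{s < t}` of fixed integrable
  functions of `u, p`, bounded independently of `t`.

## References

* G. Seregin, V. Šverák, *On Type I singularities of the local axi-symmetric solutions of the
  Navier–Stokes equations*, Comm. PDE 34 (2009), arXiv:0804.1803, §2 (p. 6), Remark 3.4 and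
  proof of Lemma 3.5, (as6). [`SereginSverak2009`]
* L. Caffarelli, R. Kohn, L. Nirenberg, *Partial regularity of suitable weak solutions of the
  Navier–Stokes equations*, CPAM 35 (1982), §2, (2.5).
* L. Escauriaza, G. Seregin, V. Šverák, *`L_{3,∞}`-solutions of Navier–Stokes equations and
  backward uniqueness*, Russ. Math. Surveys 58:2 (2003), §3, proof of Thm. 1.4.
-/

noncomputable section

open MeasureTheory TopologicalSpace Set Function Filter Metric
open scoped RealInnerProductSpace ENNReal NNReal Topology Laplacian Convolution

namespace Literature.Analysis.FluidPDE

variable {E : Type*} [NormedAddCommGroup E] [InnerProductSpace ℝ E] [FiniteDimensional ℝ E]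
  [MeasurableSpace E] [BorelSpace E]
variable {ι : Type*} [Fintype ι]

/-! ### Pointwise absorption of the cubic term -/

section Pointwise

omit [MeasurableSpace E] [BorelSpace E] in
/-- **Young absorption of the transported cubic term**: for an operator `T`, vectors `nᵢ`
and `c > 0`, `2 |Σᵢ ⟪T nᵢ, bᵢ⟫| ≤ c |T|² + (d + 1) c⁻¹ Σᵢ ‖nᵢ‖²`, `d = card ι`
(`‖T nᵢ‖ ≤ |T| ‖nᵢ‖` and `2xy ≤ εx² + ε⁻¹y²` with `ε = c/(d+1)`). [folklore] -/
theorem two_mul_abs_sum_inner_apply_le (b : OrthonormalBasis ι ℝ E) (T : E →L[ℝ] E)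
    (n : ι → E) {c : ℝ} (hc : 0 < c) :
    2 * |∑ i, ⟪T (n i), b i⟫| ≤
      c * frobeniusNormSq T + (Fintype.card ι + 1) / c * ∑ i, ‖n i‖ ^ 2 := by
  set d : ℝ := (Fintype.card ι : ℝ) with hd
  have hd0 : 0 ≤ d := by positivity
  set F : ℝ := frobeniusNormSq T with hF
  have hF0 : 0 ≤ F := frobeniusNormSq_nonneg T
  set ε : ℝ := c / (d + 1) with hε
  have hε0 : 0 < ε := by positivity
  -- per-term bound `2 |⟪T nᵢ, bᵢ⟫| ≤ ε F + ε⁻¹ ‖nᵢ‖²`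
  have hterm : ∀ i, 2 * |⟪T (n i), b i⟫| ≤ ε * F + ε⁻¹ * ‖n i‖ ^ 2 := by
    intro i
    have h1 : |⟪T (n i), b i⟫| ≤ ‖T (n i)‖ := by
      refine (abs_real_inner_le_norm _ _).trans ?_
      rw [b.orthonormal.1 i, mul_one]
    have h2 : ‖T (n i)‖ ≤ Real.sqrt F * ‖n i‖ := norm_apply_le_sqrt_frobeniusNormSq_mul T (n i)
    have h3 : 2 * (Real.sqrt F * ‖n i‖) ≤ ε * F + ε⁻¹ * ‖n i‖ ^ 2 := by
      have hsq : Real.sqrt F ^ 2 = F := Real.sq_sqrt hF0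
      have hsq' : ε ^ 2 * Real.sqrt F ^ 2 = ε ^ 2 * F := by rw [hsq]
      refine le_of_mul_le_mul_right ?_ hε0
      have e : (ε * F + ε⁻¹ * ‖n i‖ ^ 2) * ε = ε ^ 2 * F + ‖n i‖ ^ 2 := by
        have hinv : ε⁻¹ * ε = 1 := inv_mul_cancel₀ hε0.ne'
        calc (ε * F + ε⁻¹ * ‖n i‖ ^ 2) * ε = ε ^ 2 * F + (ε⁻¹ * ε) * ‖n i‖ ^ 2 := by ring
          _ = ε ^ 2 * F + ‖n i‖ ^ 2 := by rw [hinv, one_mul]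
      rw [e]
      nlinarith [sq_nonneg (ε * Real.sqrt F - ‖n i‖), hsq']
    linarith [mul_le_mul_of_nonneg_left (h1.trans h2) (by norm_num : (0 : ℝ) ≤ 2)]
  -- sum
  calc 2 * |∑ i, ⟪T (n i), b i⟫| ≤ 2 * ∑ i, |⟪T (n i), b i⟫| := by
        gcongr; exact Finset.abs_sum_le_sum_abs _ _
    _ = ∑ i, 2 * |⟪T (n i), b i⟫| := by rw [Finset.mul_sum]
    _ ≤ ∑ i, (ε * F + ε⁻¹ * ‖n i‖ ^ 2) := Finset.sum_le_sum fun i _ => hterm i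
    _ = d * (ε * F) + ε⁻¹ * ∑ i, ‖n i‖ ^ 2 := by
        rw [Finset.sum_add_distrib, Finset.sum_const, Finset.card_univ, nsmul_eq_mul, hd,
          Finset.mul_sum]
    _ ≤ c * F + (Fintype.card ι + 1) / c * ∑ i, ‖n i‖ ^ 2 := by
        have h1 : d * (ε * F) ≤ c * F := by
          have : d * ε ≤ c := by
            rw [hε, mul_div_assoc']
            rw [div_le_iff₀ (by positivity)]
            nlinarith
          calc d * (ε * F) = (d * ε) * F := by ring
            _ ≤ c * F := mul_le_mul_of_nonneg_right this hF0
        have h2 : ε⁻¹ = (Fintype.card ι + 1) / c := by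
          rw [hε, inv_div, hd]
        rw [h2] at *
        linarith

omit [FiniteDimensional ℝ E] [MeasurableSpace E] [BorelSpace E] in
/-- The transported cubic term splits off the exact transport part:
`Σᵢ ⟪T (⟪V, bᵢ⟫ • V + Rᵢ), bᵢ⟫ = ⟪T V, V⟫ + Σᵢ ⟪T Rᵢ, bᵢ⟫` (Parseval in the frame `b`).
[folklore] -/
theorem sum_inner_apply_smul_add (b : OrthonormalBasis ι ℝ E) (T : E →L[ℝ] E) (V : E)
    (R : ι → E) :
    ∑ i, ⟪T (⟪V, b i⟫ • V + R i), b i⟫ = ⟪T V, V⟫ + ∑ i, ⟪T (R i), b i⟫ := by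
  simp only [map_add, map_smul, inner_add_left, real_inner_smul_left, Finset.sum_add_distrib]
  congr 1
  have h := b.sum_inner_mul_inner (T V) V
  calc ∑ i, ⟪V, b i⟫ * ⟪T V, b i⟫ = ∑ i, ⟪T V, b i⟫ * ⟪b i, V⟫ := by
        refine Finset.sum_congr rfl fun i _ => ?_
        rw [real_inner_comm (b i) V]; ring
    _ = ⟪T V, V⟫ := h

end Pointwise

/-! ### Integrability of smooth integrands with compact `x`-support on time slabs -/

section Slab

/-- A continuous function on space–time vanishing for `x` outside a compact set is integrable
on every slab `(a, t) × E`. [folklore] -/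
theorem integrableOn_slab_of_continuous {F : ℝ × E → ℝ} {a t : ℝ} {K : Set E}
    (hK : IsCompact K) (hF : Continuous F) (hFK : ∀ s, ∀ y ∉ K, F (s, y) = 0) :
    IntegrableOn F (Ioo a t ×ˢ (univ : Set E)) volume := by
  have h := integrable_prod_of_continuousOn (a := a) (b := t) hK hF.continuousOn
    (fun s _ y hy => hFK s y hy)
  rw [Measure.restrict_prod_eq_prod_univ, ← Measure.volume_eq_prod] at h
  exact h

end Slab

/-! ### The smooth local energy inequalities -/

section Smooth

variable {ν a t : ℝ} {V : ℝ → E → E} {N : ι → ℝ → E → E} {P : ℝ → E → ℝ} {φ : ℝ → E → ℝ}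
  {Ω : Opens (ℝ × E)}

/-- **Smooth local energy inequality with the cubic term absorbed.** Under the hypotheses of
`local_energy_identity_smooth` with `ν > 0` and `φ ≥ 0`,
`∫ φ(t)|V(t)|² + ν ∫∫ φ|DV|² ≤ ∫∫ |V|²(νΔφ + ∂ₜφ) + 2 ∫∫ Σᵢ ⟪Nᵢ, ∇φ⟫Vᵢ + 2 ∫∫ P V·∇φ
  + (d+1)ν⁻¹ ∫∫ φ Σᵢ |Nᵢ|²`
(the identity, and `two_mul_abs_sum_inner_apply_le` with `c = ν`). [folklore] -/
theorem smooth_local_energy_le_absorb (b : OrthonormalBasis ι ℝ E) (hν : 0 < ν) (hat : a ≤ t)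
    (hV : ContDiff ℝ (⊤ : ℕ∞) (uncurry V)) (hN : ∀ i, ContDiff ℝ (⊤ : ℕ∞) (uncurry (N i)))
    (hP : ContDiff ℝ (⊤ : ℕ∞) (uncurry P)) (hφ : IsSpaceTimeTestOn Ω φ) (hφ0 : ∀ s y, 0 ≤ φ s y)
    (hφa : ∀ y, φ a y = 0)
    (hmom : ∀ s ∈ Ioo a t, ∀ y, φ s y ≠ 0 → ∀ i,
      ⟪timeDeriv V s y, b i⟫ + VectorCalculus.divergence (N i s) y - ν * ⟪(Δ (V s)) y, b i⟫ +
        fderiv ℝ (P s) y (b i) = 0)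
    (hdiv : ∀ s ∈ Ioo a t, ∀ y, φ s y ≠ 0 → VectorCalculus.divergence (V s) y = 0) :
    (∫ y, φ t y * ‖V t y‖ ^ 2) +
      ν * ∫ z in Ioo a t ×ˢ (univ : Set E), φ z.1 z.2 * frobeniusNormSq (fderiv ℝ (V z.1) z.2) ≤
    (∫ z in Ioo a t ×ˢ (univ : Set E),
        ‖V z.1 z.2‖ ^ 2 * (ν * (Δ (φ z.1)) z.2 + timeDeriv φ z.1 z.2)) +
      2 * (∫ z in Ioo a t ×ˢ (univ : Set E),
        ∑ i, ⟪N i z.1 z.2, gradient (φ z.1) z.2⟫ * ⟪V z.1 z.2, b i⟫) +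
      2 * (∫ z in Ioo a t ×ˢ (univ : Set E), P z.1 z.2 * ⟪V z.1 z.2, gradient (φ z.1) z.2⟫) +
      (Fintype.card ι + 1) / ν * ∫ z in Ioo a t ×ˢ (univ : Set E),
        φ z.1 z.2 * ∑ i, ‖N i z.1 z.2‖ ^ 2 := by
  have hid := local_energy_identity_smooth b hat hV hN hP hφ hφa hmom hdiv
  -- the compact `x`-shadow of `φ`
  obtain ⟨K, hK, hKt⟩ := hφ.exists_compact_slice_subset
  have hφK : ∀ s, ∀ y ∉ K, y ∉ tsupport (φ s) := fun s y hy h => hy (hKt s h)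
  have hφ0' : ∀ s, ∀ y ∉ K, φ s y = 0 := fun s y hy =>
    image_eq_zero_of_notMem_tsupport (hφK s y hy)
  have hg0 : ∀ s, ∀ y ∉ K, gradient (φ s) y = 0 := fun s y hy =>
    gradient_eq_zero_of_notMem_tsupport (hφK s y hy)
  have hΔ0 : ∀ s, ∀ y ∉ K, (Δ (φ s)) y = 0 := fun s y hy =>
    laplacian_eq_zero_of_notMem_tsupport (hφK s y hy)
  have hT0 : ∀ s, ∀ y ∉ K, timeDeriv φ s y = 0 := fun s y hy =>
    timeDeriv_eq_zero_of_forall (fun s' => hφ0' s' y hy) s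
  -- continuity of the fields involved
  have sV : IsSmoothSpaceTimeOn univ V := hV.contDiffOn
  have sφ : IsSmoothSpaceTimeOn univ φ := hφ.isSmoothSpaceTimeOn univ
  have cV : Continuous (uncurry V) := hV.continuous
  have cφ : Continuous (uncurry φ) := hφ.contDiff.continuous
  have cP : Continuous (uncurry P) := hP.continuous
  have cN : ∀ i, Continuous (uncurry (N i)) := fun i => (hN i).continuous
  have cDV : Continuous (uncurry fun s y => fderiv ℝ (V s) y) :=
    (sV.fderiv_slice uniqueDiffOn_univ).continuous_uncurry
  have cΔφ : Continuous (uncurry fun s y => (Δ (φ s)) y) :=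
    (sφ.laplacian uniqueDiffOn_univ).continuous_uncurry
  have cgφ : Continuous (uncurry fun s y => gradient (φ s) y) :=
    (sφ.gradient uniqueDiffOn_univ).continuous_uncurry
  have cTφ : Continuous (uncurry (timeDeriv φ)) := hφ.continuous_timeDeriv
  -- the integrands
  set T1 : ℝ × E → ℝ := fun z => ‖V z.1 z.2‖ ^ 2 * (ν * (Δ (φ z.1)) z.2 + timeDeriv φ z.1 z.2)
    with hT1
  set T2a : ℝ × E → ℝ := fun z => ∑ i, ⟪N i z.1 z.2, gradient (φ z.1) z.2⟫ * ⟪V z.1 z.2, b i⟫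
    with hT2a
  set T2b : ℝ × E → ℝ := fun z => φ z.1 z.2 * ∑ i, ⟪fderiv ℝ (V z.1) z.2 (N i z.1 z.2), b i⟫
    with hT2b
  set T3 : ℝ × E → ℝ := fun z => P z.1 z.2 * ⟪V z.1 z.2, gradient (φ z.1) z.2⟫ with hT3
  set Gd : ℝ × E → ℝ := fun z => φ z.1 z.2 * frobeniusNormSq (fderiv ℝ (V z.1) z.2) with hGd
  set SN : ℝ × E → ℝ := fun z => φ z.1 z.2 * ∑ i, ‖N i z.1 z.2‖ ^ 2 with hSN
  -- the identity's right-hand side in terms of these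
  have hRHS : ∀ z : ℝ × E, (‖V z.1 z.2‖ ^ 2 * (ν * (Δ (φ z.1)) z.2 + timeDeriv φ z.1 z.2) +
      2 * (∑ i, (⟪N i z.1 z.2, gradient (φ z.1) z.2⟫ * ⟪V z.1 z.2, b i⟫ +
        φ z.1 z.2 * ⟪fderiv ℝ (V z.1) z.2 (N i z.1 z.2), b i⟫)) +
      2 * (P z.1 z.2 * ⟪V z.1 z.2, gradient (φ z.1) z.2⟫)) =
      T1 z + 2 * T2a z + 2 * T2b z + 2 * T3 z := fun z => by
    have hsum : ∑ i, (⟪N i z.1 z.2, gradient (φ z.1) z.2⟫ * ⟪V z.1 z.2, b i⟫ +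
        φ z.1 z.2 * ⟪fderiv ℝ (V z.1) z.2 (N i z.1 z.2), b i⟫) = T2a z + T2b z := by
      simp only [hT2a, hT2b]
      rw [Finset.sum_add_distrib, Finset.mul_sum]
    rw [hsum]
    simp only [hT1, hT3]
    ring
  -- continuity of the integrands
  have cT1 : Continuous T1 := (cV.norm.pow 2).mul ((continuous_const.mul cΔφ).add cTφ)
  have cT2a : Continuous T2a := by
    refine continuous_finsetSum _ fun i _ => ?_
    exact ((cN i).inner cgφ).mul (cV.inner continuous_const)
  have cT2b : Continuous T2b := by
    refine cφ.mul (continuous_finsetSum _ fun i _ => ?_)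
    exact (isBoundedBilinearMap_apply.continuous.comp (cDV.prodMk (cN i))).inner continuous_const
  have cT3 : Continuous T3 := cP.mul (cV.inner cgφ)
  have cGd : Continuous Gd := cφ.mul (LerayHopfProofs.continuous_frobeniusNormSq.comp cDV)
  have cSN : Continuous SN := cφ.mul (continuous_finsetSum _ fun i _ => (cN i).norm.pow 2)
  -- vanishing off `K`
  have T10 : ∀ s, ∀ y ∉ K, T1 (s, y) = 0 := fun s y hy => by
    simp only [hT1, hΔ0 s y hy, hT0 s y hy, mul_zero, add_zero]
  have T2a0 : ∀ s, ∀ y ∉ K, T2a (s, y) = 0 := fun s y hy => by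
    simp only [hT2a, hg0 s y hy, inner_zero_right, zero_mul, Finset.sum_const_zero]
  have T2b0 : ∀ s, ∀ y ∉ K, T2b (s, y) = 0 := fun s y hy => by
    simp only [hT2b, hφ0' s y hy, zero_mul]
  have T30 : ∀ s, ∀ y ∉ K, T3 (s, y) = 0 := fun s y hy => by
    simp only [hT3, hg0 s y hy, inner_zero_right, mul_zero]
  have Gd0 : ∀ s, ∀ y ∉ K, Gd (s, y) = 0 := fun s y hy => by
    simp only [hGd, hφ0' s y hy, zero_mul]
  have SN0 : ∀ s, ∀ y ∉ K, SN (s, y) = 0 := fun s y hy => by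
    simp only [hSN, hφ0' s y hy, zero_mul]
  -- integrability on the slab
  have iT1 : IntegrableOn T1 (Ioo a t ×ˢ (univ : Set E)) volume :=
    integrableOn_slab_of_continuous hK cT1 T10
  have iT2a : IntegrableOn T2a (Ioo a t ×ˢ (univ : Set E)) volume :=
    integrableOn_slab_of_continuous hK cT2a T2a0
  have iT2b : IntegrableOn T2b (Ioo a t ×ˢ (univ : Set E)) volume :=
    integrableOn_slab_of_continuous hK cT2b T2b0
  have iT3 : IntegrableOn T3 (Ioo a t ×ˢ (univ : Set E)) volume :=
    integrableOn_slab_of_continuous hK cT3 T30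
  have iGd : IntegrableOn Gd (Ioo a t ×ˢ (univ : Set E)) volume :=
    integrableOn_slab_of_continuous hK cGd Gd0
  have iSN : IntegrableOn SN (Ioo a t ×ˢ (univ : Set E)) volume :=
    integrableOn_slab_of_continuous hK cSN SN0
  -- the pointwise absorption `2 T2b ≤ ν Gd + (d+1)/ν SN`
  have hpt : ∀ z : ℝ × E, 2 * T2b z ≤ ν * Gd z + (Fintype.card ι + 1) / ν * SN z := by
    intro z
    have h := two_mul_abs_sum_inner_apply_le b (fderiv ℝ (V z.1) z.2) (fun i => N i z.1 z.2) hν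
    have hφz := hφ0 z.1 z.2
    simp only [hT2b, hGd, hSN]
    have h2 : 2 * (φ z.1 z.2 * ∑ i, ⟪fderiv ℝ (V z.1) z.2 (N i z.1 z.2), b i⟫) ≤
        φ z.1 z.2 * (2 * |∑ i, ⟪fderiv ℝ (V z.1) z.2 (N i z.1 z.2), b i⟫|) := by
      have hle := le_abs_self (∑ i, ⟪fderiv ℝ (V z.1) z.2 (N i z.1 z.2), b i⟫)
      nlinarith [hφz, hle]
    refine h2.trans ?_
    calc φ z.1 z.2 * (2 * |∑ i, ⟪fderiv ℝ (V z.1) z.2 (N i z.1 z.2), b i⟫|)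
        ≤ φ z.1 z.2 * (ν * frobeniusNormSq (fderiv ℝ (V z.1) z.2) +
            (Fintype.card ι + 1) / ν * ∑ i, ‖N i z.1 z.2‖ ^ 2) :=
          mul_le_mul_of_nonneg_left h hφz
      _ = ν * (φ z.1 z.2 * frobeniusNormSq (fderiv ℝ (V z.1) z.2)) +
            (Fintype.card ι + 1) / ν * (φ z.1 z.2 * ∑ i, ‖N i z.1 z.2‖ ^ 2) := by ring
  -- integrate
  set S : Set (ℝ × E) := Ioo a t ×ˢ (univ : Set E) with hS
  have hRHS' : ∫ z in S, (‖V z.1 z.2‖ ^ 2 * (ν * (Δ (φ z.1)) z.2 + timeDeriv φ z.1 z.2) +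
      2 * (∑ i, (⟪N i z.1 z.2, gradient (φ z.1) z.2⟫ * ⟪V z.1 z.2, b i⟫ +
        φ z.1 z.2 * ⟪fderiv ℝ (V z.1) z.2 (N i z.1 z.2), b i⟫)) +
      2 * (P z.1 z.2 * ⟪V z.1 z.2, gradient (φ z.1) z.2⟫)) =
      (∫ z in S, T1 z) + 2 * (∫ z in S, T2a z) + 2 * (∫ z in S, T2b z) + 2 * ∫ z in S, T3 z := by
    rw [integral_congr_ae (Eventually.of_forall hRHS)]
    have i1 : Integrable (fun z => T1 z + 2 * T2a z) (volume.restrict S) :=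
      iT1.add (iT2a.const_mul 2)
    have i2 : Integrable (fun z => T1 z + 2 * T2a z + 2 * T2b z) (volume.restrict S) :=
      i1.add (iT2b.const_mul 2)
    rw [integral_add i2 (iT3.const_mul 2), integral_add i1 (iT2b.const_mul 2),
      integral_add iT1 (iT2a.const_mul 2), integral_const_mul, integral_const_mul,
      integral_const_mul]
  have hbd : ∫ z in S, T2b z ≤ (ν * ∫ z in S, Gd z) / 2 +
      ((Fintype.card ι + 1) / ν * ∫ z in S, SN z) / 2 := by
    have h1 : ∫ z in S, 2 * T2b z ≤ ∫ z in S, (ν * Gd z + (Fintype.card ι + 1) / ν * SN z) :=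
      integral_mono (iT2b.const_mul 2) ((iGd.const_mul ν).add (iSN.const_mul _))
        fun z => hpt z
    rw [integral_const_mul, integral_add (iGd.const_mul ν) (iSN.const_mul _), integral_const_mul,
      integral_const_mul] at h1
    linarith
  rw [hRHS'] at hid
  have e1 : (∫ z in S, T1 z) = ∫ z in S,
      ‖V z.1 z.2‖ ^ 2 * (ν * (Δ (φ z.1)) z.2 + timeDeriv φ z.1 z.2) := rfl
  have e2 : (∫ z in S, Gd z) = ∫ z in S, φ z.1 z.2 * frobeniusNormSq (fderiv ℝ (V z.1) z.2) := rfl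
  linarith [hid, hbd, e1, e2]

/-- **Smooth local energy inequality with the transport term split off.** Under the hypotheses
of `local_energy_identity_smooth` with `φ ≥ 0`, for every `η > 0`,
`∫ φ(t)|V(t)|² + 2ν ∫∫ φ|DV|² ≤ ∫∫ |V|²(νΔφ + ∂ₜφ) + 2 ∫∫ Σᵢ ⟪Nᵢ, ∇φ⟫Vᵢ + 2 ∫∫ P V·∇φ
  - ∫∫ |V|² V·∇φ + η ∫∫ φ|DV|² + (d+1)η⁻¹ ∫∫ φ Σᵢ |Nᵢ - Vᵢ V|²`
(the identity, `Nᵢ = VᵢV + Rᵢ`, the transport identity `2 ∫ φ⟪DV(V), V⟫ = -∫ |V|² V·∇φ` of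
`two_mul_integral_mul_inner_fderiv_self`, and `two_mul_abs_sum_inner_apply_le` with `c = η`
for the commutators `Rᵢ`). [folklore] -/
theorem smooth_local_energy_le_transport (b : OrthonormalBasis ι ℝ E) (hat : a ≤ t)
    (hV : ContDiff ℝ (⊤ : ℕ∞) (uncurry V)) (hN : ∀ i, ContDiff ℝ (⊤ : ℕ∞) (uncurry (N i)))
    (hP : ContDiff ℝ (⊤ : ℕ∞) (uncurry P)) (hφ : IsSpaceTimeTestOn Ω φ) (hφ0 : ∀ s y, 0 ≤ φ s y)
    (hφa : ∀ y, φ a y = 0)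
    (hmom : ∀ s ∈ Ioo a t, ∀ y, φ s y ≠ 0 → ∀ i,
      ⟪timeDeriv V s y, b i⟫ + VectorCalculus.divergence (N i s) y - ν * ⟪(Δ (V s)) y, b i⟫ +
        fderiv ℝ (P s) y (b i) = 0)
    (hdiv : ∀ s ∈ Ioo a t, ∀ y, φ s y ≠ 0 → VectorCalculus.divergence (V s) y = 0)
    {η : ℝ} (hη : 0 < η) :
    (∫ y, φ t y * ‖V t y‖ ^ 2) +
      2 * ν * ∫ z in Ioo a t ×ˢ (univ : Set E), φ z.1 z.2 * frobeniusNormSq (fderiv ℝ (V z.1) z.2) ≤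
    (∫ z in Ioo a t ×ˢ (univ : Set E),
        ‖V z.1 z.2‖ ^ 2 * (ν * (Δ (φ z.1)) z.2 + timeDeriv φ z.1 z.2)) +
      2 * (∫ z in Ioo a t ×ˢ (univ : Set E),
        ∑ i, ⟪N i z.1 z.2, gradient (φ z.1) z.2⟫ * ⟪V z.1 z.2, b i⟫) +
      2 * (∫ z in Ioo a t ×ˢ (univ : Set E), P z.1 z.2 * ⟪V z.1 z.2, gradient (φ z.1) z.2⟫) -
      (∫ z in Ioo a t ×ˢ (univ : Set E), ‖V z.1 z.2‖ ^ 2 * ⟪V z.1 z.2, gradient (φ z.1) z.2⟫) +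
      η * (∫ z in Ioo a t ×ˢ (univ : Set E),
        φ z.1 z.2 * frobeniusNormSq (fderiv ℝ (V z.1) z.2)) +
      (Fintype.card ι + 1) / η * ∫ z in Ioo a t ×ˢ (univ : Set E),
        φ z.1 z.2 * ∑ i, ‖N i z.1 z.2 - ⟪V z.1 z.2, b i⟫ • V z.1 z.2‖ ^ 2 := by
  have hid := local_energy_identity_smooth b hat hV hN hP hφ hφa hmom hdiv
  -- the compact `x`-shadow of `φ`
  obtain ⟨K, hK, hKt⟩ := hφ.exists_compact_slice_subset
  have hφK : ∀ s, ∀ y ∉ K, y ∉ tsupport (φ s) := fun s y hy h => hy (hKt s h)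
  have hφ0' : ∀ s, ∀ y ∉ K, φ s y = 0 := fun s y hy =>
    image_eq_zero_of_notMem_tsupport (hφK s y hy)
  have hg0 : ∀ s, ∀ y ∉ K, gradient (φ s) y = 0 := fun s y hy =>
    gradient_eq_zero_of_notMem_tsupport (hφK s y hy)
  have hΔ0 : ∀ s, ∀ y ∉ K, (Δ (φ s)) y = 0 := fun s y hy =>
    laplacian_eq_zero_of_notMem_tsupport (hφK s y hy)
  have hT0 : ∀ s, ∀ y ∉ K, timeDeriv φ s y = 0 := fun s y hy =>
    timeDeriv_eq_zero_of_forall (fun s' => hφ0' s' y hy) s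
  -- continuity of the fields involved
  have sV : IsSmoothSpaceTimeOn univ V := hV.contDiffOn
  have sφ : IsSmoothSpaceTimeOn univ φ := hφ.isSmoothSpaceTimeOn univ
  have cV : Continuous (uncurry V) := hV.continuous
  have cφ : Continuous (uncurry φ) := hφ.contDiff.continuous
  have cP : Continuous (uncurry P) := hP.continuous
  have cN : ∀ i, Continuous (uncurry (N i)) := fun i => (hN i).continuous
  have cDV : Continuous (uncurry fun s y => fderiv ℝ (V s) y) :=
    (sV.fderiv_slice uniqueDiffOn_univ).continuous_uncurry
  have cΔφ : Continuous (uncurry fun s y => (Δ (φ s)) y) :=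
    (sφ.laplacian uniqueDiffOn_univ).continuous_uncurry
  have cgφ : Continuous (uncurry fun s y => gradient (φ s) y) :=
    (sφ.gradient uniqueDiffOn_univ).continuous_uncurry
  have cTφ : Continuous (uncurry (timeDeriv φ)) := hφ.continuous_timeDeriv
  -- the commutators
  set R : ι → ℝ → E → E := fun i s y => N i s y - ⟪V s y, b i⟫ • V s y with hR
  have cR : ∀ i, Continuous (uncurry (R i)) := fun i =>
    (cN i).sub ((cV.inner continuous_const).smul cV)
  have hNR : ∀ i s y, N i s y = ⟪V s y, b i⟫ • V s y + R i s y := fun i s y => by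
    simp only [hR]; abel
  -- the integrands
  set T1 : ℝ × E → ℝ := fun z => ‖V z.1 z.2‖ ^ 2 * (ν * (Δ (φ z.1)) z.2 + timeDeriv φ z.1 z.2)
    with hT1
  set T2a : ℝ × E → ℝ := fun z => ∑ i, ⟪N i z.1 z.2, gradient (φ z.1) z.2⟫ * ⟪V z.1 z.2, b i⟫
    with hT2a
  set Tr : ℝ × E → ℝ := fun z => φ z.1 z.2 * ⟪fderiv ℝ (V z.1) z.2 (V z.1 z.2), V z.1 z.2⟫
    with hTr
  set T2c : ℝ × E → ℝ := fun z => φ z.1 z.2 * ∑ i, ⟪fderiv ℝ (V z.1) z.2 (R i z.1 z.2), b i⟫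
    with hT2c
  set T3 : ℝ × E → ℝ := fun z => P z.1 z.2 * ⟪V z.1 z.2, gradient (φ z.1) z.2⟫ with hT3
  set Gd : ℝ × E → ℝ := fun z => φ z.1 z.2 * frobeniusNormSq (fderiv ℝ (V z.1) z.2) with hGd
  set SR : ℝ × E → ℝ := fun z => φ z.1 z.2 * ∑ i, ‖R i z.1 z.2‖ ^ 2 with hSR
  set DR : ℝ × E → ℝ := fun z => ‖V z.1 z.2‖ ^ 2 * ⟪V z.1 z.2, gradient (φ z.1) z.2⟫ with hDR
  -- the identity's right-hand side in terms of these
  have hRHS : ∀ z : ℝ × E, (‖V z.1 z.2‖ ^ 2 * (ν * (Δ (φ z.1)) z.2 + timeDeriv φ z.1 z.2) +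
      2 * (∑ i, (⟪N i z.1 z.2, gradient (φ z.1) z.2⟫ * ⟪V z.1 z.2, b i⟫ +
        φ z.1 z.2 * ⟪fderiv ℝ (V z.1) z.2 (N i z.1 z.2), b i⟫)) +
      2 * (P z.1 z.2 * ⟪V z.1 z.2, gradient (φ z.1) z.2⟫)) =
      T1 z + 2 * T2a z + 2 * Tr z + 2 * T2c z + 2 * T3 z := fun z => by
    have hsplit : ∑ i, ⟪fderiv ℝ (V z.1) z.2 (N i z.1 z.2), b i⟫ =
        ⟪fderiv ℝ (V z.1) z.2 (V z.1 z.2), V z.1 z.2⟫ +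
          ∑ i, ⟪fderiv ℝ (V z.1) z.2 (R i z.1 z.2), b i⟫ := by
      rw [← sum_inner_apply_smul_add b]
      refine Finset.sum_congr rfl fun i _ => ?_
      rw [← hNR]
    have hsum : ∑ i, (⟪N i z.1 z.2, gradient (φ z.1) z.2⟫ * ⟪V z.1 z.2, b i⟫ +
        φ z.1 z.2 * ⟪fderiv ℝ (V z.1) z.2 (N i z.1 z.2), b i⟫) = T2a z + Tr z + T2c z := by
      simp only [hT2a, hTr, hT2c]
      rw [Finset.sum_add_distrib, ← Finset.mul_sum, hsplit, mul_add, add_assoc]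
    rw [hsum]
    simp only [hT1, hT3]
    ring
  -- continuity of the integrands
  have cT1 : Continuous T1 := (cV.norm.pow 2).mul ((continuous_const.mul cΔφ).add cTφ)
  have cT2a : Continuous T2a := by
    refine continuous_finsetSum _ fun i _ => ?_
    exact ((cN i).inner cgφ).mul (cV.inner continuous_const)
  have cTr : Continuous Tr :=
    cφ.mul ((isBoundedBilinearMap_apply.continuous.comp (cDV.prodMk cV)).inner cV)
  have cT2c : Continuous T2c := by
    refine cφ.mul (continuous_finsetSum _ fun i _ => ?_)
    exact (isBoundedBilinearMap_apply.continuous.comp (cDV.prodMk (cR i))).inner continuous_const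
  have cT3 : Continuous T3 := cP.mul (cV.inner cgφ)
  have cGd : Continuous Gd := cφ.mul (LerayHopfProofs.continuous_frobeniusNormSq.comp cDV)
  have cSR : Continuous SR := cφ.mul (continuous_finsetSum _ fun i _ => (cR i).norm.pow 2)
  have cDR : Continuous DR := (cV.norm.pow 2).mul (cV.inner cgφ)
  -- vanishing off `K`
  have T10 : ∀ s, ∀ y ∉ K, T1 (s, y) = 0 := fun s y hy => by
    simp only [hT1, hΔ0 s y hy, hT0 s y hy, mul_zero, add_zero]
  have T2a0 : ∀ s, ∀ y ∉ K, T2a (s, y) = 0 := fun s y hy => by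
    simp only [hT2a, hg0 s y hy, inner_zero_right, zero_mul, Finset.sum_const_zero]
  have Tr0 : ∀ s, ∀ y ∉ K, Tr (s, y) = 0 := fun s y hy => by
    simp only [hTr, hφ0' s y hy, zero_mul]
  have T2c0 : ∀ s, ∀ y ∉ K, T2c (s, y) = 0 := fun s y hy => by
    simp only [hT2c, hφ0' s y hy, zero_mul]
  have T30 : ∀ s, ∀ y ∉ K, T3 (s, y) = 0 := fun s y hy => by
    simp only [hT3, hg0 s y hy, inner_zero_right, mul_zero]
  have Gd0 : ∀ s, ∀ y ∉ K, Gd (s, y) = 0 := fun s y hy => by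
    simp only [hGd, hφ0' s y hy, zero_mul]
  have SR0 : ∀ s, ∀ y ∉ K, SR (s, y) = 0 := fun s y hy => by
    simp only [hSR, hφ0' s y hy, zero_mul]
  have DR0 : ∀ s, ∀ y ∉ K, DR (s, y) = 0 := fun s y hy => by
    simp only [hDR, hg0 s y hy, inner_zero_right, mul_zero]
  -- integrability on the slab
  set S : Set (ℝ × E) := Ioo a t ×ˢ (univ : Set E) with hS
  have iT1 : IntegrableOn T1 S volume := integrableOn_slab_of_continuous hK cT1 T10
  have iT2a : IntegrableOn T2a S volume := integrableOn_slab_of_continuous hK cT2a T2a0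
  have iTr : IntegrableOn Tr S volume := integrableOn_slab_of_continuous hK cTr Tr0
  have iT2c : IntegrableOn T2c S volume := integrableOn_slab_of_continuous hK cT2c T2c0
  have iT3 : IntegrableOn T3 S volume := integrableOn_slab_of_continuous hK cT3 T30
  have iGd : IntegrableOn Gd S volume := integrableOn_slab_of_continuous hK cGd Gd0
  have iSR : IntegrableOn SR S volume := integrableOn_slab_of_continuous hK cSR SR0
  have iDR : IntegrableOn DR S volume := integrableOn_slab_of_continuous hK cDR DR0
  -- the pointwise absorption of the commutator term `2 T2c ≤ η Gd + (d+1)/η SR`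
  have hpt : ∀ z : ℝ × E, 2 * T2c z ≤ η * Gd z + (Fintype.card ι + 1) / η * SR z := by
    intro z
    have h := two_mul_abs_sum_inner_apply_le b (fderiv ℝ (V z.1) z.2) (fun i => R i z.1 z.2) hη
    have hφz := hφ0 z.1 z.2
    simp only [hT2c, hGd, hSR]
    have h2 : 2 * (φ z.1 z.2 * ∑ i, ⟪fderiv ℝ (V z.1) z.2 (R i z.1 z.2), b i⟫) ≤
        φ z.1 z.2 * (2 * |∑ i, ⟪fderiv ℝ (V z.1) z.2 (R i z.1 z.2), b i⟫|) := by
      have hle := le_abs_self (∑ i, ⟪fderiv ℝ (V z.1) z.2 (R i z.1 z.2), b i⟫)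
      nlinarith [hφz, hle]
    refine h2.trans ?_
    calc φ z.1 z.2 * (2 * |∑ i, ⟪fderiv ℝ (V z.1) z.2 (R i z.1 z.2), b i⟫|)
        ≤ φ z.1 z.2 * (η * frobeniusNormSq (fderiv ℝ (V z.1) z.2) +
            (Fintype.card ι + 1) / η * ∑ i, ‖R i z.1 z.2‖ ^ 2) :=
          mul_le_mul_of_nonneg_left h hφz
      _ = η * (φ z.1 z.2 * frobeniusNormSq (fderiv ℝ (V z.1) z.2)) +
            (Fintype.card ι + 1) / η * (φ z.1 z.2 * ∑ i, ‖R i z.1 z.2‖ ^ 2) := by ring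
  -- the transport identity `2 ∫_S Tr = -∫_S DR`
  have htr : 2 * ∫ z in S, Tr z = -∫ z in S, DR z := by
    have iTr' := integrable_prod_of_continuousOn (a := a) (b := t) hK cTr.continuousOn
      (fun s _ y hy => Tr0 s y hy)
    have iDR' := integrable_prod_of_continuousOn (a := a) (b := t) hK cDR.continuousOn
      (fun s _ y hy => DR0 s y hy)
    have hsl : ∀ s ∈ Ioo a t, 2 * ∫ y, Tr (s, y) = -∫ y, DR (s, y) := by
      intro s hs
      have hV1 : ContDiff ℝ 1 (V s) := (sV.contDiff_slice (mem_univ s)).of_le (by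
        exact_mod_cast le_top)
      have hφ1 : ContDiff ℝ 1 (φ s) := (IsSpaceTimeTestOn.contDiff_slice hφ s).of_le (by
        exact_mod_cast le_top)
      exact two_mul_integral_mul_inner_fderiv_self hV1 hφ1 (hφ.hasCompactSupport_slice s)
        (fun y hy => hdiv s hs y hy)
    rw [hS, setIntegral_prod_univ_eq iTr', setIntegral_prod_univ_eq iDR', ← integral_neg,
      ← integral_const_mul]
    exact setIntegral_congr_fun measurableSet_Ioo fun s hs => hsl s hs
  -- integrate
  have hRHS' : ∫ z in S, (‖V z.1 z.2‖ ^ 2 * (ν * (Δ (φ z.1)) z.2 + timeDeriv φ z.1 z.2) +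
      2 * (∑ i, (⟪N i z.1 z.2, gradient (φ z.1) z.2⟫ * ⟪V z.1 z.2, b i⟫ +
        φ z.1 z.2 * ⟪fderiv ℝ (V z.1) z.2 (N i z.1 z.2), b i⟫)) +
      2 * (P z.1 z.2 * ⟪V z.1 z.2, gradient (φ z.1) z.2⟫)) =
      (∫ z in S, T1 z) + 2 * (∫ z in S, T2a z) + 2 * (∫ z in S, Tr z) + 2 * (∫ z in S, T2c z) +
        2 * ∫ z in S, T3 z := by
    rw [integral_congr_ae (Eventually.of_forall hRHS)]
    have i1 : Integrable (fun z => T1 z + 2 * T2a z) (volume.restrict S) :=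
      iT1.add (iT2a.const_mul 2)
    have i2 : Integrable (fun z => T1 z + 2 * T2a z + 2 * Tr z) (volume.restrict S) :=
      i1.add (iTr.const_mul 2)
    have i3 : Integrable (fun z => T1 z + 2 * T2a z + 2 * Tr z + 2 * T2c z) (volume.restrict S) :=
      i2.add (iT2c.const_mul 2)
    rw [integral_add i3 (iT3.const_mul 2), integral_add i2 (iT2c.const_mul 2),
      integral_add i1 (iTr.const_mul 2), integral_add iT1 (iT2a.const_mul 2), integral_const_mul,
      integral_const_mul, integral_const_mul, integral_const_mul]
  have hbd : ∫ z in S, T2c z ≤ (η * ∫ z in S, Gd z) / 2 +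
      ((Fintype.card ι + 1) / η * ∫ z in S, SR z) / 2 := by
    have h1 : ∫ z in S, 2 * T2c z ≤ ∫ z in S, (η * Gd z + (Fintype.card ι + 1) / η * SR z) :=
      integral_mono (iT2c.const_mul 2) ((iGd.const_mul η).add (iSR.const_mul _))
        fun z => hpt z
    rw [integral_const_mul, integral_add (iGd.const_mul η) (iSR.const_mul _), integral_const_mul,
      integral_const_mul] at h1
    linarith
  rw [hRHS'] at hid
  have e1 : (∫ z in S, T1 z) = ∫ z in S,
      ‖V z.1 z.2‖ ^ 2 * (ν * (Δ (φ z.1)) z.2 + timeDeriv φ z.1 z.2) := rfl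
  have e2 : (∫ z in S, Gd z) = ∫ z in S, φ z.1 z.2 * frobeniusNormSq (fderiv ℝ (V z.1) z.2) := rfl
  have e3 : (∫ z in S, DR z) = ∫ z in S, ‖V z.1 z.2‖ ^ 2 * ⟪V z.1 z.2, gradient (φ z.1) z.2⟫ := rfl
  have e4 : (∫ z in S, SR z) = ∫ z in S,
      φ z.1 z.2 * ∑ i, ‖N i z.1 z.2 - ⟪V z.1 z.2, b i⟫ • V z.1 z.2‖ ^ 2 := rfl
  linarith [hid, hbd, htr, e1, e2, e3, e4]

end Smooth

/-! ### Auxiliary lemmas for the mollified fields -/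

section Aux

omit [InnerProductSpace ℝ E] [FiniteDimensional ℝ E] [MeasurableSpace E] [BorelSpace E] in
/-- `∫⁻ ‖f‖ₑⁿ < ∞` for a natural exponent `n ≠ 0` gives `f ∈ Lⁿ`. [folklore] -/
theorem memLp_nat_of_lintegral_lt_top {X : Type*} [MeasurableSpace X] {μ : Measure X}
    {F : Type*} [NormedAddCommGroup F] {f : X → F} (hf : AEStronglyMeasurable f μ) {n : ℕ}
    (hn : n ≠ 0) (h : ∫⁻ x, ‖f x‖ₑ ^ n ∂μ < ∞) : MemLp f n μ := by
  refine ⟨hf, ?_⟩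
  have h1 : eLpNorm f n μ ^ n < ∞ := by
    rw [eLpNorm_natCast_pow_eq_lintegral' _ hn]; exact h
  by_contra htop
  rw [not_lt, top_le_iff] at htop
  rw [htop, ENNReal.top_pow hn] at h1
  exact lt_irrefl _ h1

omit [InnerProductSpace ℝ E] [FiniteDimensional ℝ E] [MeasurableSpace E] [BorelSpace E] in
/-- An essentially bounded `L²` function is in `L⁴` (`‖f‖⁴ ≤ K² ‖f‖²`). [folklore] -/
theorem memLp_four_of_bound {X : Type*} [MeasurableSpace X] {μ : Measure X}
    {F : Type*} [NormedAddCommGroup F] {f : X → F} (hf : MemLp f 2 μ) {K : ℝ}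
    (hK : ∀ᵐ x ∂μ, ‖f x‖ ≤ K) : MemLp f 4 μ := by
  have h4 : ((4 : ℕ) : ℝ≥0∞) = 4 := by norm_num
  rw [← h4]
  refine memLp_nat_of_lintegral_lt_top hf.1 (by norm_num) ?_
  have h2 : ∫⁻ x, ‖f x‖ₑ ^ 2 ∂μ < ∞ := by
    rw [← MollifiedLimits.eLpNorm_two_pow_two]
    exact ENNReal.pow_lt_top hf.eLpNorm_lt_top
  have hle : ∀ᵐ x ∂μ, ‖f x‖ₑ ^ 4 ≤ ENNReal.ofReal K ^ 2 * ‖f x‖ₑ ^ 2 := by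
    filter_upwards [hK] with x hx
    have h1 : ‖f x‖ₑ ≤ ENNReal.ofReal K := by
      rw [← ofReal_norm]; exact ENNReal.ofReal_le_ofReal hx
    calc ‖f x‖ₑ ^ 4 = ‖f x‖ₑ ^ 2 * ‖f x‖ₑ ^ 2 := by ring
      _ ≤ ENNReal.ofReal K ^ 2 * ‖f x‖ₑ ^ 2 := by gcongr
  calc ∫⁻ x, ‖f x‖ₑ ^ 4 ∂μ ≤ ∫⁻ x, ENNReal.ofReal K ^ 2 * ‖f x‖ₑ ^ 2 ∂μ := lintegral_mono_ae hle
    _ = ENNReal.ofReal K ^ 2 * ∫⁻ x, ‖f x‖ₑ ^ 2 ∂μ := by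
        rw [lintegral_const_mul' _ _ (ENNReal.pow_ne_top ENNReal.ofReal_ne_top)]
    _ < ∞ := ENNReal.mul_lt_top (ENNReal.pow_lt_top ENNReal.ofReal_lt_top) h2

omit [InnerProductSpace ℝ E] [FiniteDimensional ℝ E] [MeasurableSpace E] [BorelSpace E] in
/-- A closed ball of radius `r < δ` about a point at time `≤ t` lies in the half-space
`{s < t + δ}` (the time coordinate is `1`-Lipschitz for the product distance). [folklore] -/
theorem closedBall_subset_time_lt {z : ℝ × E} {r t δ : ℝ} (hz : z.1 ≤ t) (hr : r < δ) :
    closedBall z r ⊆ {w : ℝ × E | w.1 < t + δ} := by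
  intro w hw
  rw [mem_closedBall, Prod.dist_eq] at hw
  have h1 : dist w.1 z.1 ≤ r := (le_max_left _ _).trans hw
  rw [Real.dist_eq] at h1
  have : w.1 - z.1 ≤ r := (le_abs_self _).trans h1
  show w.1 < t + δ
  linarith

omit [InnerProductSpace ℝ E] [FiniteDimensional ℝ E] [MeasurableSpace E] [BorelSpace E] in
/-- The absolute value of a set integral is at most the integral of the norm. [folklore] -/
theorem abs_setIntegral_le_integral_norm {X : Type*} [MeasurableSpace X] {μ : Measure X}
    {f : X → ℝ} (hf : Integrable f μ) (S : Set X) : |∫ x in S, f x ∂μ| ≤ ∫ x, ‖f x‖ ∂μ := by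
  rw [← Real.norm_eq_abs]
  refine (norm_integral_le_integral_norm _).trans ?_
  exact setIntegral_le_integral hf.norm (Eventually.of_forall fun x => norm_nonneg _)

omit [InnerProductSpace ℝ E] [FiniteDimensional ℝ E] [MeasurableSpace E] [BorelSpace E] in
/-- `∫ ‖f‖² = (‖f‖_{L²}²).toReal` for `f ∈ L²`. [folklore] -/
private theorem integral_norm_sq_eq_toReal_aux {X : Type*} [MeasurableSpace X] {μ : Measure X}
    {F : Type*} [NormedAddCommGroup F] {f : X → F} (hf : MemLp f 2 μ) :
    ∫ x, ‖f x‖ ^ 2 ∂μ = (eLpNorm f 2 μ ^ 2).toReal := by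
  rw [MollifiedLimits.eLpNorm_two_pow_two,
    integral_eq_lintegral_of_nonneg_ae (Eventually.of_forall fun x => sq_nonneg _)
      (hf.1.norm.pow 2)]
  congr 1
  refine lintegral_congr fun x => ?_
  rw [← ofReal_norm, ← ENNReal.ofReal_pow (norm_nonneg _)]

end Aux

/-! ### The main estimate -/

section Main

set_option maxHeartbeats 1600000 in
/-- **Uniform local energy bound for the mollifications of a distributional solution bounded
away from the final time** (the content of Seregin–Šverák 2009, Remark 3.4 and §2, p. 6,
"condition (b8) allows us to extend this property to the whole cylinder `Q`"; see the module
docstring). Let `(u, p)` solve the Navier–Stokes system (viscosity `ν > 0`, no force) in the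
sense of distributions on a bounded open `Q ⊆ ℝ × E` with `u ∈ L³(Q)`, `p ∈ L^{3/2}(Q)`; let
`φ ≥ 0` be a space–time test function with `φ(a, ·) = 0` and `kₙ` normalised bump kernels with
radii `→ 0`. Then there is `M` such that for every `t ≥ a` and `δ > 0` with
`closedBall z δ ⊆ Q` for all `z ∈ supp φ`, `z.1 ≤ t`, and `u` essentially bounded on
`Q ∩ {s < t + δ}`, the mollifications `Vₙ = kₙ ⋆ 𝟙_Q u` satisfy, for all large `n`,
`∫ φ(t)|Vₙ(t)|² + 2ν ∫∫_{(a,t)×E} φ |D Vₙ|² ≤ M`.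
[cite: SereginSverak2009, Remark 3.4 and proof of Lemma 3.5 (as6)] -/
theorem exists_eventually_mollified_energy_le
    {Q : Opens (ℝ × E)} (hQb : Bornology.IsBounded (Q : Set (ℝ × E)))
    {ν : ℝ} (hν : 0 < ν) {u : ℝ → E → E} {p : ℝ → E → ℝ}
    (hNS : IsDistributionalNSSolutionOn Q ν 0 u p)
    (hu3 : ∫⁻ z in (Q : Set (ℝ × E)), ‖u z.1 z.2‖ₑ ^ (3 : ℕ) < ∞)
    (hp : ∫⁻ z in (Q : Set (ℝ × E)), ‖p z.1 z.2‖ₑ ^ (3 / 2 : ℝ) < ∞)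
    {φ : ℝ → E → ℝ} {Ω : Opens (ℝ × E)} (hφ : IsSpaceTimeTestOn Ω φ) (hφ0 : ∀ s y, 0 ≤ φ s y)
    {a : ℝ} (hφa : ∀ y, φ a y = 0)
    (bump : ℕ → ContDiffBump (0 : ℝ × E)) (hbr : Tendsto (fun n => (bump n).rOut) atTop (𝓝 0)) :
    ∃ M : ℝ, ∀ t, a ≤ t → ∀ δ > (0 : ℝ),
      (∀ z ∈ tsupport (uncurry φ), z.1 ≤ t → closedBall z δ ⊆ (Q : Set (ℝ × E))) →
      (∃ K : ℝ, ∀ᵐ z ∂(volume.restrict (Q : Set (ℝ × E))), z.1 < t + δ → ‖u z.1 z.2‖ ≤ K) →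
      ∀ᶠ n in atTop,
        (∫ y, φ t y * ‖stMollify ((bump n).normed volume) (zeroExt Q u) t y‖ ^ 2) +
          2 * ν * ∫ z in Ioo a t ×ˢ (univ : Set E), φ z.1 z.2 *
            frobeniusNormSq (fderiv ℝ (stMollify ((bump n).normed volume) (zeroExt Q u) z.1) z.2)
          ≤ M := by
  haveI : (volume : Measure (ℝ × E)).IsAddHaarMeasure := Measure.prod.instIsAddHaarMeasure _ _
  -- small constants in `ℝ≥0∞` and Hölder triples
  have one_le_three_halves : (1 : ℝ≥0∞) ≤ 3 / 2 := by
    have h : (1 : ℝ≥0∞) = 2 / 2 := (ENNReal.div_self two_ne_zero ENNReal.ofNat_ne_top).symm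
    rw [h]; gcongr; norm_num
  have three_halves_ne_top : (3 / 2 : ℝ≥0∞) ≠ ∞ := ENNReal.div_ne_top (by norm_num) (by norm_num)
  have three_halves_ne_zero : (3 / 2 : ℝ≥0∞) ≠ 0 :=
    (ENNReal.div_pos (by norm_num) (by norm_num)).ne'
  haveI hHT442 : ENNReal.HolderTriple 4 4 2 := by
    simpa using holderTriple_ofReal (a := 4) (b := 4) (c := 2) (by norm_num) (by norm_num)
      (by norm_num) (by norm_num)
  haveI hHT33 : ENNReal.HolderTriple 3 3 (3 / 2) := by
    have h := holderTriple_ofReal (a := 3) (b := 3) (c := 3 / 2) (by norm_num) (by norm_num)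
      (by norm_num) (by norm_num)
    rwa [ENNReal.ofReal_ofNat, ENNReal.ofReal_div_of_pos (by norm_num), ENNReal.ofReal_ofNat,
      ENNReal.ofReal_ofNat] at h
  haveI hHT31 : ENNReal.HolderTriple (3 / 2) 3 1 := by
    have h := holderTriple_ofReal (a := 3 / 2) (b := 3) (c := 1) (by norm_num) (by norm_num)
      (by norm_num) (by norm_num)
    rwa [ENNReal.ofReal_ofNat, ENNReal.ofReal_div_of_pos (by norm_num), ENNReal.ofReal_ofNat,
      ENNReal.ofReal_ofNat, ENNReal.ofReal_one] at h
  haveI hHT13 : ENNReal.HolderTriple 3 (3 / 2) 1 := by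
    have h := holderTriple_ofReal (a := 3) (b := 3 / 2) (c := 1) (by norm_num) (by norm_num)
      (by norm_num) (by norm_num)
    rwa [ENNReal.ofReal_ofNat, ENNReal.ofReal_div_of_pos (by norm_num), ENNReal.ofReal_ofNat,
      ENNReal.ofReal_ofNat, ENNReal.ofReal_one] at h
  haveI hHT22 : ENNReal.HolderTriple 2 2 1 := ENNReal.HolderConjugate.instTwoTwo
  set b := stdOrthonormalBasis ℝ E with hb
  -- ## (0) the region and the space–time classes of `u`, `p`
  have hQm : MeasurableSet (Q : Set (ℝ × E)) := Q.isOpen.measurableSet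
  haveI : IsFiniteMeasure (volume.restrict (Q : Set (ℝ × E))) :=
    ⟨by rw [Measure.restrict_apply_univ]; exact hQb.measure_lt_top⟩
  have hvm : AEStronglyMeasurable (uncurry u) (volume.restrict (Q : Set (ℝ × E))) :=
    hNS.1.aestronglyMeasurable
  have hpm : AEStronglyMeasurable (uncurry p) (volume.restrict (Q : Set (ℝ × E))) :=
    hNS.2.2.1.aestronglyMeasurable
  have hv3Q : MemLp (uncurry u) 3 (volume.restrict (Q : Set (ℝ × E))) := by
    have := memLp_nat_of_lintegral_lt_top hvm (n := 3) (by norm_num) (by exact hu3)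
    simpa using this
  have hv2Q : MemLp (uncurry u) 2 (volume.restrict (Q : Set (ℝ × E))) :=
    hv3Q.mono_exponent (by norm_num)
  have hpQ : MemLp (uncurry p) (3 / 2) (volume.restrict (Q : Set (ℝ × E))) := by
    refine memLp_of_lintegral_rpow_lt_top three_halves_ne_zero three_halves_ne_top hpm ?_
    have : ((3 : ℝ≥0∞) / 2).toReal = 3 / 2 := by rw [ENNReal.toReal_div]; norm_num
    rw [this]; exact hp
  have hvI : IntegrableOn (uncurry u) (Q : Set (ℝ × E)) volume := hv2Q.integrable one_le_two
  have hv2I : IntegrableOn (fun z => ‖uncurry u z‖ ^ 2) (Q : Set (ℝ × E)) volume :=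
    hv2Q.integrable_norm_pow two_ne_zero
  have hpI : IntegrableOn (uncurry p) (Q : Set (ℝ × E)) volume := hpQ.integrable one_le_three_halves
  -- ## (1) the zero extensions
  set ũ : ℝ × E → E := zeroExt Q u with hũ
  set pt : ℝ × E → ℝ := zeroExt Q p with hpt
  have hũ2 : MemLp ũ 2 volume := memLp_zeroExt rfl hQm hv2Q
  have hũ3 : MemLp ũ 3 volume := memLp_zeroExt rfl hQm hv3Q
  have hpt32 : MemLp pt (3 / 2) volume := memLp_zeroExt rfl hQm hpQ
  have hũi : LocallyIntegrable ũ volume := locallyIntegrable_zeroExt hvI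
  have hpti : LocallyIntegrable pt volume := locallyIntegrable_zeroExt hpI
  set Nt : Fin (Module.finrank ℝ E) → ℝ × E → E := fun i =>
    zeroExt Q fun t x => ⟪u t x, b i⟫ • u t x with hNt
  have hNt' : ∀ i, Nt i = fun z => ⟪ũ z, b i⟫ • ũ z := fun i => by
    rw [hNt]; exact zeroExt_inner_smul u (b i)
  have hNt32 : ∀ i, MemLp (Nt i) (3 / 2) volume := fun i => by
    rw [hNt' i]
    have := memLp_bilin (p := 3) (q := 3) (r := 3 / 2) (innerSmulBilin (b i)) hũ3 hũ3
    simpa [innerSmulBilin_apply] using this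
  have hNti : ∀ i, IntegrableOn (uncurry fun t x => ⟪u t x, b i⟫ • u t x) (Q : Set (ℝ × E))
      volume := by
    intro i
    refine Integrable.mono' (hv2I.mul_const ‖b i‖) ?_ (Eventually.of_forall fun z => ?_)
    · exact (hvI.aestronglyMeasurable.inner aestronglyMeasurable_const).smul
        hvI.aestronglyMeasurable
    · change ‖⟪u z.1 z.2, b i⟫ • u z.1 z.2‖ ≤ ‖uncurry u z‖ ^ 2 * ‖b i‖
      rw [norm_smul]
      calc ‖⟪u z.1 z.2, b i⟫‖ * ‖u z.1 z.2‖ ≤ (‖u z.1 z.2‖ * ‖b i‖) * ‖u z.1 z.2‖ := by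
            gcongr; exact norm_inner_le_norm _ _
        _ = ‖uncurry u z‖ ^ 2 * ‖b i‖ := by rw [show uncurry u z = u z.1 z.2 from rfl]; ring
  have hNtli : ∀ i, LocallyIntegrable (Nt i) volume := fun i => locallyIntegrable_zeroExt (hNti i)
  -- ## (2) the mollifiers and the mollified fields
  set k : ℕ → ℝ × E → ℝ := fun n => (bump n).normed volume with hk
  have hkinf : ∀ n, ContDiff ℝ (⊤ : ℕ∞) (k n) := fun n => (bump n).contDiff_normed
  have hkr : ∀ n w, w ∉ closedBall (0 : ℝ × E) (bump n).rOut → k n w = 0 := fun n w hw => by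
    have : w ∉ Function.support (k n) := by
      rw [hk, (bump n).support_normed_eq]; exact fun h => hw (ball_subset_closedBall h)
    simpa using this
  have hkc : ∀ n, HasCompactSupport (k n) := fun n => (bump n).hasCompactSupport_normed
  set V : ℕ → ℝ → E → E := fun n => stMollify (k n) ũ with hV
  set Pm : ℕ → ℝ → E → ℝ := fun n => stMollify (k n) pt with hPm
  set N : ℕ → Fin (Module.finrank ℝ E) → ℝ → E → E := fun n i => stMollify (k n) (Nt i) with hN
  have hVsm : ∀ n, ContDiff ℝ (⊤ : ℕ∞) (uncurry (V n)) := fun n =>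
    contDiff_uncurry_stMollify (hkinf n) (hkc n) hũi
  have hPsm : ∀ n, ContDiff ℝ (⊤ : ℕ∞) (uncurry (Pm n)) := fun n =>
    contDiff_uncurry_stMollify (hkinf n) (hkc n) hpti
  have hNsm : ∀ n i, ContDiff ℝ (⊤ : ℕ∞) (uncurry (N n i)) := fun n i =>
    contDiff_uncurry_stMollify (hkinf n) (hkc n) (hNtli i)
  have hVc : ∀ n, Continuous (uncurry (V n)) := fun n => (hVsm n).continuous
  -- whole-space convergence of the mollifications
  have cV2 : Tendsto (fun n => eLpNorm (uncurry (V n) - ũ) 2 volume) atTop (𝓝 0) :=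
    FunctionSpaces.tendsto_eLpNorm_normed_convolution_sub_self hbr (by norm_num) (by norm_num) hũ2
  have cV3 : Tendsto (fun n => eLpNorm (uncurry (V n) - ũ) 3 volume) atTop (𝓝 0) :=
    FunctionSpaces.tendsto_eLpNorm_normed_convolution_sub_self hbr (by norm_num) (by norm_num) hũ3
  have cP : Tendsto (fun n => eLpNorm (uncurry (Pm n) - pt) (3 / 2) volume) atTop (𝓝 0) :=
    FunctionSpaces.tendsto_eLpNorm_normed_convolution_sub_self hbr one_le_three_halves
      three_halves_ne_top hpt32
  have cN : ∀ i, Tendsto (fun n => eLpNorm (uncurry (N n i) - Nt i) (3 / 2) volume) atTop (𝓝 0) :=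
    fun i => FunctionSpaces.tendsto_eLpNorm_normed_convolution_sub_self hbr one_le_three_halves
      three_halves_ne_top (hNt32 i)
  -- whole-space classes of the mollifications
  have mV2 : ∀ n, MemLp (uncurry (V n)) 2 volume := fun n =>
    UnboundedOperators.memLp_convolution_lsmul (bump n).integrable_normed hũ2 (by norm_num)
  have mV3 : ∀ n, MemLp (uncurry (V n)) 3 volume := fun n =>
    UnboundedOperators.memLp_convolution_lsmul (bump n).integrable_normed hũ3 (by norm_num)
  have mP : ∀ n, MemLp (uncurry (Pm n)) (3 / 2) volume := fun n =>
    UnboundedOperators.memLp_convolution_lsmul (bump n).integrable_normed hpt32 one_le_three_halves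
  have mN : ∀ n i, MemLp (uncurry (N n i)) (3 / 2) volume := fun n i =>
    UnboundedOperators.memLp_convolution_lsmul (bump n).integrable_normed (hNt32 i)
      one_le_three_halves
  -- ## (3) the weights built from `φ` and their bounds
  have sφ : IsSmoothSpaceTimeOn univ φ := hφ.isSmoothSpaceTimeOn univ
  have cφ : Continuous (uncurry φ) := hφ.contDiff.continuous
  have cgφ : Continuous (uncurry fun s y => gradient (φ s) y) :=
    (sφ.gradient uniqueDiffOn_univ).continuous_uncurry
  have cΔφ : Continuous (uncurry fun s y => (Δ (φ s)) y) :=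
    (sφ.laplacian uniqueDiffOn_univ).continuous_uncurry
  have cTφ : Continuous (uncurry (timeDeriv φ)) := hφ.continuous_timeDeriv
  set wΔ : ℝ × E → ℝ := fun z => ν * (Δ (φ z.1)) z.2 + timeDeriv φ z.1 z.2 with hwΔ
  set wφ : ℝ × E → ℝ := fun z => φ z.1 z.2 with hwφ
  set wg : ℝ × E → E →L[ℝ] ℝ := fun z => innerSL ℝ (gradient (φ z.1) z.2) with hwg
  have cwΔ : Continuous wΔ := (continuous_const.mul cΔφ).add cTφ
  have cwg : Continuous wg := (innerSL ℝ).continuous.comp cgφ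
  have hsuppφ : HasCompactSupport (uncurry φ) := hφ.hasCompactSupport
  have hw0 : ∀ z, z ∉ tsupport (uncurry φ) → wφ z = 0 ∧ wg z = 0 ∧ wΔ z = 0 := fun z hz => by
    obtain ⟨h1, h2, h3, h4⟩ := weights_eq_zero_of_notMem_tsupport hz
    refine ⟨h1, ?_, ?_⟩
    · simp only [hwg, h2, map_zero]
    · simp only [hwΔ, h3, h4, mul_zero, add_zero]
  obtain ⟨CΔ, hCΔ⟩ := cwΔ.bounded_above_of_compact_support
    (hsuppφ.mono' fun z hz => by by_contra h; exact hz (hw0 z h).2.2)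
  obtain ⟨Cφ, hCφ⟩ := cφ.bounded_above_of_compact_support hsuppφ
  obtain ⟨Cg, hCg⟩ := cwg.bounded_above_of_compact_support
    (hsuppφ.mono' fun z hz => by by_contra h; exact hz (hw0 z h).2.1)
  have hCφ0 : 0 ≤ Cφ := (norm_nonneg _).trans (hCφ (a, 0))
  obtain ⟨Kx, hKx, hKxt⟩ := hφ.exists_compact_slice_subset
  have hφKx : ∀ s, ∀ y ∉ Kx, φ s y = 0 := fun s y hy =>
    image_eq_zero_of_notMem_tsupport fun h => hy (hKxt s h)
  have mwΔ : AEStronglyMeasurable wΔ volume := cwΔ.aestronglyMeasurable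
  have mwφ : AEStronglyMeasurable wφ volume := cφ.aestronglyMeasurable
  have mwg : AEStronglyMeasurable wg volume := cwg.aestronglyMeasurable
  have bwΔ : ∀ᵐ z ∂(volume : Measure (ℝ × E)), ‖wΔ z‖ ≤ CΔ := Eventually.of_forall hCΔ
  have bwφ : ∀ᵐ z ∂(volume : Measure (ℝ × E)), ‖wφ z‖ ≤ Cφ := Eventually.of_forall hCφ
  have bwg : ∀ᵐ z ∂(volume : Measure (ℝ × E)), ‖wg z‖ ≤ Cg := Eventually.of_forall hCg
  -- the bilinear forms
  set βI : E →L[ℝ] E →L[ℝ] ℝ := innerSL ℝ with hβI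
  set βs : ℝ →L[ℝ] E →L[ℝ] E := ContinuousLinearMap.lsmul ℝ ℝ with hβs
  have βI_apply : ∀ x y : E, βI x y = ⟪x, y⟫ := fun x y => rfl
  have βs_apply : ∀ (r : ℝ) (x : E), βs r x = r • x := fun r x => rfl
  have wg_apply : ∀ (z : ℝ × E) (x : E), wg z x = ⟪gradient (φ z.1) z.2, x⟫ := fun z x => rfl
  -- ## (4) the limit integrands and the `t`-independent bound
  set Φ1 : ℝ × E → ℝ := fun z => wΔ z * βI (ũ z) (ũ z) with hΦ1
  set Φ2 : Fin (Module.finrank ℝ E) → ℝ × E → ℝ := fun i z =>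
    wg z (innerSmulBilin (b i) (ũ z) (Nt i z)) with hΦ2
  set Φ3 : ℝ × E → ℝ := fun z => wg z (βs (pt z) (ũ z)) with hΦ3
  set Φ4 : ℝ × E → ℝ := fun z => wg z (βs (βI (ũ z) (ũ z)) (ũ z)) with hΦ4
  have msq0 : MemLp (fun z => βI (ũ z) (ũ z)) (3 / 2) volume :=
    memLp_bilin (p := 3) (q := 3) (r := 3 / 2) βI hũ3 hũ3
  have iΦ1 : Integrable Φ1 volume := integrable_mul_bilin_of_memLp (p := 2) (q := 2) βI hũ2 hũ2 mwΔ bwΔ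
  have iΦ2 : ∀ i, Integrable (Φ2 i) volume := fun i =>
    integrable_clm_bilin_of_memLp (p := 3) (q := 3 / 2) (innerSmulBilin (b i)) hũ3 (hNt32 i) mwg bwg
  have iΦ3 : Integrable Φ3 volume := integrable_clm_bilin_of_memLp (p := 3 / 2) (q := 3) βs hpt32 hũ3 mwg bwg
  have iΦ4 : Integrable Φ4 volume := integrable_clm_bilin_of_memLp (p := 3 / 2) (q := 3) βs msq0 hũ3 mwg bwg
  set B1 : ℝ := ∫ z, ‖Φ1 z‖ with hB1
  set B2 : ℝ := ∑ i, ∫ z, ‖Φ2 i z‖ with hB2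
  set B3 : ℝ := ∫ z, ‖Φ3 z‖ with hB3
  set B4 : ℝ := ∫ z, ‖Φ4 z‖ with hB4
  refine ⟨B1 + 2 * B2 + 2 * B3 + B4 + 2, fun t hat δ hδ hgeo hbdd => ?_⟩
  -- ## (5) a fixed time `t`: the localised fields
  obtain ⟨Kb, hKb⟩ := hbdd
  set H : Set (ℝ × E) := {w | w.1 < t + δ} with hH
  have hHm : MeasurableSet H := measurableSet_lt measurable_fst measurable_const
  set uQ : ℝ × E → E := H.indicator ũ with huQ
  have huQ2 : MemLp uQ 2 volume := by rw [huQ]; exact hũ2.indicator hHm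
  have huQ3 : MemLp uQ 3 volume := by rw [huQ]; exact hũ3.indicator hHm
  have huQbd : ∀ᵐ z ∂(volume : Measure (ℝ × E)), ‖uQ z‖ ≤ |Kb| := by
    have h1 : ∀ᵐ z ∂(volume : Measure (ℝ × E)), z ∈ (Q : Set (ℝ × E)) →
        (z.1 < t + δ → ‖u z.1 z.2‖ ≤ Kb) := (ae_restrict_iff' hQm).1 hKb
    filter_upwards [h1] with z hz
    by_cases hzH : z ∈ H
    · rw [huQ, indicator_of_mem hzH]
      by_cases hzQ : z ∈ (Q : Set (ℝ × E))
      · rw [hũ, zeroExt_of_mem _ hzQ]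
        exact (hz hzQ hzH).trans (le_abs_self _)
      · rw [hũ, zeroExt_of_not_mem _ hzQ, norm_zero]; exact abs_nonneg _
    · rw [huQ, indicator_of_notMem hzH, norm_zero]; exact abs_nonneg _
  have huQ4 : MemLp uQ 4 volume := memLp_four_of_bound huQ2 huQbd
  set NQ : Fin (Module.finrank ℝ E) → ℝ × E → E := fun i z => ⟪uQ z, b i⟫ • uQ z with hNQ
  have hNQ2 : ∀ i, MemLp (NQ i) 2 volume := fun i => by
    have := memLp_bilin (p := 4) (q := 4) (r := 2) (innerSmulBilin (b i)) huQ4 huQ4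
    simpa [hNQ, innerSmulBilin_apply] using this
  set VQ : ℕ → ℝ → E → E := fun n => stMollify (k n) uQ with hVQ
  set NQm : ℕ → Fin (Module.finrank ℝ E) → ℝ → E → E := fun n i => stMollify (k n) (NQ i) with hNQm
  have cVQ4 : Tendsto (fun n => eLpNorm (uncurry (VQ n) - uQ) 4 volume) atTop (𝓝 0) :=
    FunctionSpaces.tendsto_eLpNorm_normed_convolution_sub_self hbr (by norm_num) (by norm_num) huQ4
  have cNQ : ∀ i, Tendsto (fun n => eLpNorm (uncurry (NQm n i) - NQ i) 2 volume) atTop (𝓝 0) :=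
    fun i => FunctionSpaces.tendsto_eLpNorm_normed_convolution_sub_self hbr (by norm_num) (by norm_num) (hNQ2 i)
  have mVQ4 : ∀ n, MemLp (uncurry (VQ n)) 4 volume := fun n =>
    UnboundedOperators.memLp_convolution_lsmul (bump n).integrable_normed huQ4 (by norm_num)
  have mNQ : ∀ n i, MemLp (uncurry (NQm n i)) 2 volume := fun n i =>
    UnboundedOperators.memLp_convolution_lsmul (bump n).integrable_normed (hNQ2 i) (by norm_num)
  have eNQm : ∀ n i, eLpNorm (uncurry (NQm n i)) 2 volume ≤ eLpNorm (NQ i) 2 volume := fun n i =>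
    FunctionSpaces.eLpNorm_normed_convolution_le_haar (bump n) (hNQ2 i).1 one_le_two
  -- locality: below time `t` the mollified fields only see `uQ`
  have hloc : ∀ n, (bump n).rOut < δ → ∀ z : ℝ × E, z.1 ≤ t →
      V n z.1 z.2 = VQ n z.1 z.2 ∧ ∀ i, N n i z.1 z.2 = NQm n i z.1 z.2 := by
    intro n hn z hz
    have hsub : closedBall z (bump n).rOut ⊆ H := closedBall_subset_time_lt hz hn
    have e1 : EqOn ũ uQ (closedBall z (bump n).rOut) := fun w hw => by
      rw [huQ, indicator_of_mem (hsub hw)]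
    have e2 : ∀ i, EqOn (Nt i) (NQ i) (closedBall z (bump n).rOut) := fun i w hw => by
      rw [hNt' i]
      simp only [hNQ, huQ, indicator_of_mem (hsub hw)]
    exact ⟨convolution_lsmul_congr_of_eqOn (hkr n) e1,
      fun i => convolution_lsmul_congr_of_eqOn (hkr n) (e2 i)⟩
  -- ## (6) the mollified equations on `{φ ≠ 0}` below time `t`
  have hmem : ∀ {s : ℝ} {y : E}, s < t → φ s y ≠ 0 → closedBall ((s, y) : ℝ × E) δ ⊆
      (Q : Set (ℝ × E)) := fun {s y} hs h =>
    hgeo (s, y) (subset_tsupport _ (by exact h)) hs.le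
  have hEQ : ∀ n, (bump n).rOut ≤ δ → ∀ s ∈ Ioo a t, ∀ y, φ s y ≠ 0 →
      (∀ i, ⟪timeDeriv (V n) s y, b i⟫ + VectorCalculus.divergence (N n i s) y -
        ν * ⟪(Δ (V n s)) y, b i⟫ + fderiv ℝ (Pm n s) y (b i) = 0) ∧
      VectorCalculus.divergence (V n s) y = 0 := by
    intro n hn s hs y hy
    have hsub : closedBall ((s, y) : ℝ × E) (bump n).rOut ⊆ (Q : Set (ℝ × E)) :=
      (closedBall_subset_closedBall hn).trans (hmem hs.2 hy)
    exact ⟨fun i => hNS.mollified_momentum hvI hv2I hpI (hkinf n) (hkr n) hsub (b i),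
      hNS.divergence_mollified_eq_zero hvI (hkinf n) (hkr n) hsub⟩
  -- ## (7) the two smooth inequalities, for large `n`
  set S : Set (ℝ × E) := Ioo a t ×ˢ (univ : Set E) with hS_def
  have hSm : MeasurableSet S := measurableSet_Ioo.prod MeasurableSet.univ
  set c₁ : ℝ := (Fintype.card (Fin (Module.finrank ℝ E)) + 1 : ℝ) with hc₁
  have hc₁0 : 0 < c₁ := by rw [hc₁]; positivity
  -- the terms
  set L0 : ℕ → ℝ := fun n => ∫ y, φ t y * ‖V n t y‖ ^ 2 with hL0
  set Gd : ℕ → ℝ := fun n => ∫ z in S, φ z.1 z.2 * frobeniusNormSq (fderiv ℝ (V n z.1) z.2) with hGd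
  set T1 : ℕ → ℝ := fun n => ∫ z in S, ‖V n z.1 z.2‖ ^ 2 * (ν * (Δ (φ z.1)) z.2 + timeDeriv φ z.1 z.2)
    with hT1
  set T2a : ℕ → ℝ := fun n => ∫ z in S, ∑ i, ⟪N n i z.1 z.2, gradient (φ z.1) z.2⟫ * ⟪V n z.1 z.2, b i⟫
    with hT2a
  set T3 : ℕ → ℝ := fun n => ∫ z in S, Pm n z.1 z.2 * ⟪V n z.1 z.2, gradient (φ z.1) z.2⟫ with hT3
  set DR : ℕ → ℝ := fun n => ∫ z in S, ‖V n z.1 z.2‖ ^ 2 * ⟪V n z.1 z.2, gradient (φ z.1) z.2⟫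
    with hDR
  set SN : ℕ → ℝ := fun n => ∫ z in S, φ z.1 z.2 * ∑ i, ‖N n i z.1 z.2‖ ^ 2 with hSN
  set SR : ℕ → ℝ := fun n => ∫ z in S,
    φ z.1 z.2 * ∑ i, ‖N n i z.1 z.2 - ⟪V n z.1 z.2, b i⟫ • V n z.1 z.2‖ ^ 2 with hSR
  have hL0nn : ∀ n, 0 ≤ L0 n := fun n =>
    integral_nonneg fun y => mul_nonneg (hφ0 t y) (sq_nonneg _)
  have hGdnn : ∀ n, 0 ≤ Gd n := fun n =>
    setIntegral_nonneg hSm fun z _ => mul_nonneg (hφ0 z.1 z.2) (frobeniusNormSq_nonneg _)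
  have hI1 : ∀ n, (bump n).rOut ≤ δ → L0 n + ν * Gd n ≤ T1 n + 2 * T2a n + 2 * T3 n + c₁ / ν * SN n :=
    fun n hn => smooth_local_energy_le_absorb b hν hat (hVsm n) (hNsm n) (hPsm n) hφ hφ0 hφa
      (fun s hs y hy => (hEQ n hn s hs y hy).1) (fun s hs y hy => (hEQ n hn s hs y hy).2)
  have hI2 : ∀ n, (bump n).rOut ≤ δ → ∀ {η : ℝ}, 0 < η →
      L0 n + 2 * ν * Gd n ≤ T1 n + 2 * T2a n + 2 * T3 n - DR n + η * Gd n + c₁ / η * SR n :=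
    fun n hn η hη => smooth_local_energy_le_transport b hat (hVsm n) (hNsm n) (hPsm n) hφ hφ0 hφa
      (fun s hs y hy => (hEQ n hn s hs y hy).1) (fun s hs y hy => (hEQ n hn s hs y hy).2) hη
  -- ## (8) the `T`-forms of the terms and their limits
  have eT1 : ∀ n, T1 n = ∫ z in S, wΔ z * βI (uncurry (V n) z) (uncurry (V n) z) := fun n => by
    refine integral_congr_ae (Eventually.of_forall fun z => ?_)
    dsimp only
    rw [βI_apply, real_inner_self_eq_norm_sq, mul_comm]; rfl
  have iT2ai : ∀ n i, Integrable (fun z => wg z (innerSmulBilin (b i) (uncurry (V n) z)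
      (uncurry (N n i) z))) (volume : Measure (ℝ × E)) := fun n i =>
    integrable_clm_bilin_of_memLp (p := 3) (q := 3 / 2) _ (mV3 n) (mN n i) mwg bwg
  have eT2a : ∀ n, T2a n = ∑ i, ∫ z in S, wg z (innerSmulBilin (b i) (uncurry (V n) z)
      (uncurry (N n i) z)) := fun n => by
    rw [← integral_finsetSum _ fun i _ => (iT2ai n i).integrableOn]
    refine integral_congr_ae (Eventually.of_forall fun z => ?_)
    dsimp only
    refine Finset.sum_congr rfl fun i _ => ?_
    rw [wg_apply, innerSmulBilin_apply, real_inner_smul_right, real_inner_comm]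
    simp only [uncurry]; ring
  have eT3 : ∀ n, T3 n = ∫ z in S, wg z (βs (uncurry (Pm n) z) (uncurry (V n) z)) := fun n => by
    refine integral_congr_ae (Eventually.of_forall fun z => ?_)
    dsimp only
    rw [wg_apply, βs_apply, real_inner_smul_right, real_inner_comm]; rfl
  have eDR : ∀ n, DR n = ∫ z in S, wg z (βs (βI (uncurry (V n) z) (uncurry (V n) z))
      (uncurry (V n) z)) := fun n => by
    refine integral_congr_ae (Eventually.of_forall fun z => ?_)
    dsimp only
    rw [wg_apply, βs_apply, βI_apply, real_inner_smul_right, real_inner_self_eq_norm_sq,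
      real_inner_comm]; rfl
  -- the limits
  have limT1 : Tendsto T1 atTop (𝓝 (∫ z in S, Φ1 z)) := by
    have h := tendsto_setIntegral_mul_bilin (p := 2) (q := 2) one_le_two βI mV2 hũ2 mV2 hũ2 cV2 cV2
      mwΔ bwΔ S
    refine h.congr' (Eventually.of_forall fun n => (eT1 n).symm)
  have limT2a : Tendsto T2a atTop (𝓝 (∑ i, ∫ z in S, Φ2 i z)) := by
    have h : ∀ i, Tendsto (fun n => ∫ z in S, wg z (innerSmulBilin (b i) (uncurry (V n) z)
        (uncurry (N n i) z))) atTop (𝓝 (∫ z in S, Φ2 i z)) := fun i =>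
      tendsto_setIntegral_clm_bilin (p := 3) (q := 3 / 2) one_le_three_halves (innerSmulBilin (b i))
        mV3 hũ3 (fun n => mN n i) (hNt32 i) cV3 (cN i) mwg bwg S
    refine (tendsto_finsetSum _ fun i _ => h i).congr' (Eventually.of_forall fun n => (eT2a n).symm)
  have limT3 : Tendsto T3 atTop (𝓝 (∫ z in S, Φ3 z)) := by
    have h := tendsto_setIntegral_clm_bilin (p := 3 / 2) (q := 3) (by norm_num) βs mP hpt32 mV3 hũ3
      cP cV3 mwg bwg S
    exact h.congr' (Eventually.of_forall fun n => (eT3 n).symm)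
  have limDR : Tendsto DR atTop (𝓝 (∫ z in S, Φ4 z)) := by
    have msq : ∀ n, MemLp (fun z => βI (uncurry (V n) z) (uncurry (V n) z)) (3 / 2) volume :=
      fun n => memLp_bilin (p := 3) (q := 3) (r := 3 / 2) βI (mV3 n) (mV3 n)
    have csq : Tendsto (fun n => eLpNorm ((fun z => βI (uncurry (V n) z) (uncurry (V n) z)) -
        fun z => βI (ũ z) (ũ z)) (3 / 2) volume) atTop (𝓝 0) :=
      tendsto_eLpNorm_bilin_sub (p := 3) (q := 3) (r := 3 / 2) (by norm_num) one_le_three_halves βI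
        (fun n => (mV3 n).1) hũ3.1 (fun n => (mV3 n).1) hũ3.1 hũ3.eLpNorm_lt_top
        hũ3.eLpNorm_lt_top cV3 cV3
    have h := tendsto_setIntegral_clm_bilin (p := 3 / 2) (q := 3) (by norm_num) βs msq msq0 mV3 hũ3
      csq cV3 mwg bwg S
    exact h.congr' (Eventually.of_forall fun n => (eDR n).symm)
  -- bounds of the limits, independent of `t`
  have bT1 : |∫ z in S, Φ1 z| ≤ B1 := abs_setIntegral_le_integral_norm iΦ1 S
  have bT2a : |∑ i, ∫ z in S, Φ2 i z| ≤ B2 :=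
    (Finset.abs_sum_le_sum_abs _ _).trans (Finset.sum_le_sum fun i _ =>
      abs_setIntegral_le_integral_norm (iΦ2 i) S)
  have bT3 : |∫ z in S, Φ3 z| ≤ B3 := abs_setIntegral_le_integral_norm iΦ3 S
  have bDR : |∫ z in S, Φ4 z| ≤ B4 := abs_setIntegral_le_integral_norm iΦ4 S
  -- eventually bounds
  have evT1 : ∀ᶠ n in atTop, T1 n ≤ B1 + 1 / 4 :=
    limT1.eventually_le_const (by linarith [le_abs_self (∫ z in S, Φ1 z)])
  have evT2a : ∀ᶠ n in atTop, T2a n ≤ B2 + 1 / 8 :=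
    limT2a.eventually_le_const (by linarith [le_abs_self (∑ i, ∫ z in S, Φ2 i z)])
  have evT3 : ∀ᶠ n in atTop, T3 n ≤ B3 + 1 / 8 :=
    limT3.eventually_le_const (by linarith [le_abs_self (∫ z in S, Φ3 z)])
  have evDR : ∀ᶠ n in atTop, -DR n ≤ B4 + 1 / 4 :=
    limDR.neg.eventually_le_const (by linarith [neg_abs_le (∫ z in S, Φ4 z)])
  have evr : ∀ᶠ n in atTop, (bump n).rOut < δ := (tendsto_order.1 hbr).2 δ hδ
  -- ## (9) pass one: the dissipation below `t` is bounded
  -- `SN n ≤ Cφ Σᵢ ‖NQ i‖₂²` for `rₙ < δ`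
  set B5 : ℝ := Cφ * ∑ i, (eLpNorm (NQ i) 2 volume ^ 2).toReal with hB5
  have hSN : ∀ n, (bump n).rOut < δ → SN n ≤ B5 := by
    intro n hn
    have iNQ2 : ∀ i, Integrable (fun z => ‖uncurry (NQm n i) z‖ ^ 2) (volume : Measure (ℝ × E)) :=
      fun i => (mNQ n i).integrable_norm_pow two_ne_zero
    have hpt : ∀ z ∈ S, φ z.1 z.2 * ∑ i, ‖N n i z.1 z.2‖ ^ 2 ≤
        Cφ * ∑ i, ‖uncurry (NQm n i) z‖ ^ 2 := by
      intro z hz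
      have hzt : z.1 ≤ t := le_of_lt hz.1.2
      obtain ⟨-, hNl⟩ := hloc n hn z hzt
      have e : ∑ i, ‖N n i z.1 z.2‖ ^ 2 = ∑ i, ‖uncurry (NQm n i) z‖ ^ 2 :=
        Finset.sum_congr rfl fun i _ => by rw [hNl i]; rfl
      rw [e]
      refine mul_le_mul_of_nonneg_right ?_ (Finset.sum_nonneg fun i _ => sq_nonneg _)
      exact (le_abs_self _).trans ((Real.norm_eq_abs _).symm.le.trans (hCφ z))
    have cL : Continuous fun z : ℝ × E => φ z.1 z.2 * ∑ i, ‖N n i z.1 z.2‖ ^ 2 :=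
      cφ.mul (continuous_finsetSum _ fun i _ => (hNsm n i).continuous.norm.pow 2)
    have iL : IntegrableOn (fun z : ℝ × E => φ z.1 z.2 * ∑ i, ‖N n i z.1 z.2‖ ^ 2) S volume :=
      integrableOn_slab_of_continuous hKx cL fun s y hy => by simp only [hφKx s y hy, zero_mul]
    calc SN n ≤ ∫ z in S, Cφ * ∑ i, ‖uncurry (NQm n i) z‖ ^ 2 :=
          setIntegral_mono_on iL ((integrable_finsetSum _ fun i _ => iNQ2 i).const_mul Cφ
            |>.integrableOn) hSm hpt
      _ ≤ ∫ z, Cφ * ∑ i, ‖uncurry (NQm n i) z‖ ^ 2 :=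
          setIntegral_le_integral ((integrable_finsetSum _ fun i _ => iNQ2 i).const_mul Cφ)
            (Eventually.of_forall fun z => mul_nonneg hCφ0 (Finset.sum_nonneg fun i _ => sq_nonneg _))
      _ = Cφ * ∑ i, ∫ z, ‖uncurry (NQm n i) z‖ ^ 2 := by
          rw [integral_const_mul, integral_finsetSum _ fun i _ => iNQ2 i]
      _ ≤ B5 := by
          rw [hB5]
          refine mul_le_mul_of_nonneg_left (Finset.sum_le_sum fun i _ => ?_) hCφ0
          rw [integral_norm_sq_eq_toReal_aux (mNQ n i)]
          exact ENNReal.toReal_mono (ENNReal.pow_ne_top (hNQ2 i).eLpNorm_ne_top)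
            (pow_le_pow_left' (eNQm n i) 2)
  set M₁ : ℝ := (B1 + 1 / 4 + 2 * (B2 + 1 / 8) + 2 * (B3 + 1 / 8) + c₁ / ν * B5) / ν with hM₁
  have evGd : ∀ᶠ n in atTop, Gd n ≤ M₁ := by
    filter_upwards [evT1, evT2a, evT3, evr] with n h1 h2 h3 hr
    have h := hI1 n hr.le
    have h5 := hSN n hr
    have h6 : c₁ / ν * SN n ≤ c₁ / ν * B5 := mul_le_mul_of_nonneg_left h5 (div_nonneg hc₁0.le hν.le)
    rw [hM₁, le_div_iff₀ hν]
    linarith only [h, h1, h2, h3, h6, hL0nn n]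
  have hM₁0 : 0 ≤ M₁ := by
    obtain ⟨n, hn⟩ := evGd.exists
    exact (hGdnn n).trans hn
  -- ## (10) pass two: the commutators vanish in the limit
  set η : ℝ := 1 / (4 * (M₁ + 1)) with hη
  have h4M : 0 < 4 * (M₁ + 1) := by linarith only [hM₁0]
  have hη0 : 0 < η := by rw [hη]; exact div_pos one_pos h4M
  have hηM : η * M₁ ≤ 1 / 4 := by
    rw [hη, one_div_mul_eq_div, div_le_div_iff₀ h4M (by norm_num)]
    linarith only [hM₁0]
  -- `SR n ≤ Cφ Σᵢ ‖RQ n i‖₂²` with `RQ n i = NQm n i - ⟪VQ n, bᵢ⟫ VQ n → 0` in `L²`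
  set RQ : ℕ → Fin (Module.finrank ℝ E) → ℝ × E → E := fun n i z =>
    uncurry (NQm n i) z - ⟪uncurry (VQ n) z, b i⟫ • uncurry (VQ n) z with hRQ
  have mPQ : ∀ n i, MemLp (fun z => ⟪uncurry (VQ n) z, b i⟫ • uncurry (VQ n) z) 2 volume :=
    fun n i => by
    have := memLp_bilin (p := 4) (q := 4) (r := 2) (innerSmulBilin (b i)) (mVQ4 n) (mVQ4 n)
    simpa [innerSmulBilin_apply] using this
  have mRQ : ∀ n i, MemLp (RQ n i) 2 volume := fun n i => (mNQ n i).sub (mPQ n i)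
  have cRQ : ∀ i, Tendsto (fun n => eLpNorm (RQ n i) 2 volume) atTop (𝓝 0) := by
    intro i
    have hP : Tendsto (fun n => eLpNorm ((fun z => ⟪uncurry (VQ n) z, b i⟫ • uncurry (VQ n) z) -
        fun z => ⟪uQ z, b i⟫ • uQ z) 2 volume) atTop (𝓝 0) := by
      have h := tendsto_eLpNorm_bilin_sub (p := 4) (q := 4) (r := 2) (by norm_num) (by norm_num)
        (innerSmulBilin (b i)) (fun n => (mVQ4 n).1) huQ4.1 (fun n => (mVQ4 n).1) huQ4.1
        huQ4.eLpNorm_lt_top huQ4.eLpNorm_lt_top cVQ4 cVQ4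
      refine h.congr fun n => ?_
      congr 1
      funext z
      simp only [Pi.sub_apply, innerSmulBilin_apply]
    have hle : ∀ n, eLpNorm (RQ n i) 2 volume ≤ eLpNorm (uncurry (NQm n i) - NQ i) 2 volume +
        eLpNorm ((fun z => ⟪uncurry (VQ n) z, b i⟫ • uncurry (VQ n) z) -
          fun z => ⟪uQ z, b i⟫ • uQ z) 2 volume := by
      intro n
      have e : RQ n i = (uncurry (NQm n i) - NQ i) -
          ((fun z => ⟪uncurry (VQ n) z, b i⟫ • uncurry (VQ n) z) - fun z => ⟪uQ z, b i⟫ • uQ z) := by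
        funext z
        simp only [hRQ, hNQ, Pi.sub_apply]
        abel
      rw [e]
      exact eLpNorm_sub_le (((mNQ n i).sub (hNQ2 i)).1) (((mPQ n i).sub (by
        have := memLp_bilin (p := 4) (q := 4) (r := 2) (innerSmulBilin (b i)) huQ4 huQ4
        simpa [innerSmulBilin_apply] using this)).1) one_le_two
    have hlim : Tendsto (fun n => eLpNorm (uncurry (NQm n i) - NQ i) 2 volume +
        eLpNorm ((fun z => ⟪uncurry (VQ n) z, b i⟫ • uncurry (VQ n) z) -
          fun z => ⟪uQ z, b i⟫ • uQ z) 2 volume) atTop (𝓝 0) := by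
      simpa using (cNQ i).add hP
    exact tendsto_of_tendsto_of_tendsto_of_le_of_le tendsto_const_nhds hlim (fun n => zero_le) hle
  have hSR : ∀ n, (bump n).rOut < δ → SR n ≤ Cφ * ∑ i, (eLpNorm (RQ n i) 2 volume ^ 2).toReal := by
    intro n hn
    have iRQ2 : ∀ i, Integrable (fun z => ‖RQ n i z‖ ^ 2) (volume : Measure (ℝ × E)) :=
      fun i => (mRQ n i).integrable_norm_pow two_ne_zero
    have hpt : ∀ z ∈ S, φ z.1 z.2 * ∑ i, ‖N n i z.1 z.2 - ⟪V n z.1 z.2, b i⟫ • V n z.1 z.2‖ ^ 2 ≤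
        Cφ * ∑ i, ‖RQ n i z‖ ^ 2 := by
      intro z hz
      have hzt : z.1 ≤ t := le_of_lt hz.1.2
      obtain ⟨hVl, hNl⟩ := hloc n hn z hzt
      have e : ∑ i, ‖N n i z.1 z.2 - ⟪V n z.1 z.2, b i⟫ • V n z.1 z.2‖ ^ 2 = ∑ i, ‖RQ n i z‖ ^ 2 :=
        Finset.sum_congr rfl fun i _ => by rw [hNl i, hVl]; rfl
      rw [e]
      refine mul_le_mul_of_nonneg_right ?_ (Finset.sum_nonneg fun i _ => sq_nonneg _)
      exact (le_abs_self _).trans ((Real.norm_eq_abs _).symm.le.trans (hCφ z))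
    have cL : Continuous fun z : ℝ × E =>
        φ z.1 z.2 * ∑ i, ‖N n i z.1 z.2 - ⟪V n z.1 z.2, b i⟫ • V n z.1 z.2‖ ^ 2 :=
      cφ.mul (continuous_finsetSum _ fun i _ =>
        ((hNsm n i).continuous.sub (((hVc n).inner continuous_const).smul (hVc n))).norm.pow 2)
    have iL : IntegrableOn (fun z : ℝ × E =>
        φ z.1 z.2 * ∑ i, ‖N n i z.1 z.2 - ⟪V n z.1 z.2, b i⟫ • V n z.1 z.2‖ ^ 2) S volume :=
      integrableOn_slab_of_continuous hKx cL fun s y hy => by simp only [hφKx s y hy, zero_mul]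
    calc SR n ≤ ∫ z in S, Cφ * ∑ i, ‖RQ n i z‖ ^ 2 :=
          setIntegral_mono_on iL ((integrable_finsetSum _ fun i _ => iRQ2 i).const_mul Cφ
            |>.integrableOn) hSm hpt
      _ ≤ ∫ z, Cφ * ∑ i, ‖RQ n i z‖ ^ 2 :=
          setIntegral_le_integral ((integrable_finsetSum _ fun i _ => iRQ2 i).const_mul Cφ)
            (Eventually.of_forall fun z => mul_nonneg hCφ0 (Finset.sum_nonneg fun i _ => sq_nonneg _))
      _ = Cφ * ∑ i, ∫ z, ‖RQ n i z‖ ^ 2 := by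
          rw [integral_const_mul, integral_finsetSum _ fun i _ => iRQ2 i]
      _ = Cφ * ∑ i, (eLpNorm (RQ n i) 2 volume ^ 2).toReal := by
          congr 1
          exact Finset.sum_congr rfl fun i _ => integral_norm_sq_eq_toReal_aux (mRQ n i)
  have evSR : ∀ᶠ n in atTop, c₁ / η * SR n ≤ 1 / 4 := by
    -- `Σᵢ (‖RQ n i‖₂²).toReal → 0`
    have h1 : ∀ i, Tendsto (fun n => (eLpNorm (RQ n i) 2 volume ^ 2).toReal) atTop (𝓝 0) := by
      intro i
      have h2 : Tendsto (fun n => eLpNorm (RQ n i) 2 volume ^ 2) atTop (𝓝 0) := by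
        have := ((ENNReal.continuous_pow 2).tendsto 0).comp (cRQ i)
        rwa [zero_pow two_ne_zero] at this
      have h3 := (ENNReal.tendsto_toReal ENNReal.zero_ne_top).comp h2
      rwa [ENNReal.toReal_zero] at h3
    have h4 : Tendsto (fun n => c₁ / η * (Cφ * ∑ i, (eLpNorm (RQ n i) 2 volume ^ 2).toReal)) atTop
        (𝓝 0) := by
      have h5 : Tendsto (fun n => ∑ i, (eLpNorm (RQ n i) 2 volume ^ 2).toReal) atTop
          (𝓝 (∑ i : Fin (Module.finrank ℝ E), (0 : ℝ))) :=
        tendsto_finsetSum Finset.univ fun i _ => h1 i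
      rw [Finset.sum_const_zero] at h5
      have := (h5.const_mul Cφ).const_mul (c₁ / η)
      simpa using this
    filter_upwards [h4.eventually_le_const (by norm_num : (0 : ℝ) < 1 / 4), evr] with n hn hr
    exact (mul_le_mul_of_nonneg_left (hSR n hr) (div_nonneg hc₁0.le hη0.le)).trans hn
  -- ## (11) conclusion
  filter_upwards [evT1, evT2a, evT3, evDR, evGd, evSR, evr] with n h1 h2 h3 h4 h5 h6 hr
  have h := hI2 n hr.le hη0
  have h7 : η * Gd n ≤ 1 / 4 := (mul_le_mul_of_nonneg_left h5 hη0.le).trans hηM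
  show L0 n + 2 * ν * Gd n ≤ B1 + 2 * B2 + 2 * B3 + B4 + 2
  linarith only [h, h1, h2, h3, h4, h6, h7]

end Main

end Literature.Analysis.FluidPDE
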